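import Literature.NumberTheory.LFunctions.Zhang2022.SkeletonPartTwo
import Literature.NumberTheory.LFunctions.Zhang2022.Section10Defs
import Literature.NumberTheory.LFunctions.Zhang2022.Section10Lemma101Tent

/-!
# Zhang (2022), typed statements of §10, second half (PDF pp. 56–62): the evaluations of
# `Θ₁(𝐚₁₁,𝐚₁₃)`, `Θ₁(𝐚₁₃,𝐚₂₁)`, `Θ₁(𝐚₁₄,𝐚₂₂)`, `Θ₁(𝐚₁₂,𝐚₁₄)` ((10.12)–(10.16)) and the end of the proof of
# Proposition 2.4 ((10.17), `𝔡′`, `𝔡`)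

Topic `Literature/NumberTheory/LFunctions/Zhang2022` (Landau–Siegel audit tree; verdict-neutral).
Y. Zhang, *Discrete mean estimates and the Landau–Siegel zero*, arXiv:2211.02515v1 (2022)
[Zhang2022LandauSiegel], §10 from the display after Lemma 10.2 (p. 56, TeX L2869) to the Remark
closing §10 (p. 62, TeX L3175) — **an unrefereed manuscript under adjudication: every
`def … : Prop` below is a CLAIM OF THE MANUSCRIPT, STATED NOT ASSERTED** (campaign D-0069, layer L3,
file `TypedSection10B`, DAG nodes `Z22:§10.u027 … Z22:§10.u067`). Nothing here asserts or denies
Theorems 1–2 of the manuscript.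

What this file does. The banked skeleton types this stretch of §10 as ONE coarse proof node
`Skeleton.Ded1017 c′ : Eq101 → Prop71 → Lemma82 → Lemma83 → Lemma84 → Lemma101 → Lemma102 → Eval1017`
("(10.1) + Prop. 7.1 + Lemmas 8.2–8.4, 10.1, 10.2 ⇒ (10.17)"). Here every displayed intermediate
claim of that passage is typed over the skeleton's real objects (`Skeleton.Sj`, `Theta1`, `a11 … a22`,
`lamZero`, `xiZero`, `betaJ`, `frakv1`, `fraky1/2`, `frakfW`, `frakgW`, `vk1/2/3`, `ftilde`, `frakA`,
`frakP`, `alpha`, `bigP`, `bigT`, `t0`, `alphaTilde`) and the tree's transcription of the printed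
constants (`Section10Defs`: `yy11 … yy23`, `d3F/d31 …`, `d4F`, `d5pF`, `d5F`, `d6pF`, `d6F`, `dprime`,
`dfrak`, `Ineq10a–d`, `Prop24Main`; `Section8Defs`: `ff16 …`, `gh16 …`, `iota2`; `Section18Defs`:
`iota3`, `iota4`) — CITED, never restated. Each "`X = Y + o(α)`" line is
`∀ ε > 0, ForAllLarge (A → ‖X − Y‖ ≤ ε·α)`, each "`= c𝔞 + o(1)`" is `… ≤ ε`, each "`= c𝔞𝔓 + o(𝔓)`" is
`… ≤ ε·𝔓` (skeleton conventions, `SkeletonPropositions` §3), literally as printed (see the note on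
`o(1)` vs `o(𝔞)` at `Concl1113`).

| node (DAG.tsv) | locator | decl(s) here / in the tree | kind |
|---|---|---|---|
| §10.u027–u030 | p. 56, after Lemma 10.2 | tree `Zhang2022.yy12, yy22, yy13, yy23` (`Section10Defs`); `yy1Sel`, `yy2Sel` | OBJECT (cited) |
| §10.u031 | p. 56, Remark | `mellinKernelShift`, `RemarkMellinShift` | CLAIM |
| §10.u032, u033 | p. 57 | `frakv1S`, `frakv2S`, `yShift`, `Lemma101S c′`, `Lemma102S c′`; PROVED `frakv1S_eq_frakv1`, edge `lemma101S_of_lemma101` | OBJECT + CLAIM + EDGE |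
| §10.u034 | p. 57 | `mSum11`, `nSum13`, `drSumAll`, `drSum`, `IdSj1113 c′` | OBJECT + CLAIM |
| §10.u035 | p. 57 | `Split1113 c′` | CLAIM |
| §10.u036 | p. 57 | `nAvg`, `Eq1036a/b/c c′` | CLAIM ×3 |
| §10.u037, u038 | p. 57 | `Eq1037a/b c′`, `Eq1038a/b c′` | CLAIM ×4 |
| §10.u039 | p. 58 | `nQuad`, `BetaProd1039 c′` | CLAIM |
| §10.u040, u041 | p. 58 | `Concl1113 c′`; tree `d3F`, `d31–d33`; `d3Sel` | CLAIM / OBJECT |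
| (10.12) | p. 58 | `Eq1012 c′` | CLAIM |
| §10.u042 | p. 58 | `mSum13`, `nSum21`, `IdSj1321 c′`, `Split1321 c′`, `Small1321 c′` | OBJECT + CLAIM |
| §10.u043, u044 | p. 58 | `Eq1043a/b c′`, `Eq1044a/b c′` | CLAIM ×4 |
| §10.u045, u046, (10.13) | p. 59 | `Concl1321 c′`; tree `d4F`, `d41–d43`; `d4Sel`; `Eq1013 c′` | CLAIM / OBJECT |
| §10.u047, u048 | p. 59 | `mSum14`, `nSum22`, `IdSj1422 c′`, `Split1422 c′`, `Small1422 c′` | OBJECT + CLAIM |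
| §10.u049, u050 | pp. 59–60 | `Eq1049a/b c′`, `Eq1050a/b c′` | CLAIM ×4 |
| §10.u051–u053, (10.14) | p. 60 | `Concl1422 c′`; tree `d5pF`, `d5F`, `d5p1–3`, `d51–53`; `d5pSel`, `d5Sel`; `Eq1014 c′` | CLAIM / OBJECT |
| §10.u054 | p. 60 | `mSum12`, `nSum14`, `IdSj1214 c′`, `Split1214 c′` | OBJECT + CLAIM |
| §10.u055–u057 | pp. 60–61 | `Eq1055a/b/c c′`, `Eq1056a/b c′`, `Eq1057a/b c′` | CLAIM ×7 |
| §10.u058, (10.15), u059, (10.16) | p. 61 | `Concl1214 c′`; tree `d6pF`, `d6F`, `d6p1–3`, `d61–63`; `d6pSel`, `d6Sel`; `Eq1016 c′` | CLAIM / OBJECT |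
| (10.17) | p. 61 | skeleton `Skeleton.Eval1017 c′` (banked); refinement `Ded1017Fine c′` + PROVED edge `ded1017Fine_holds` | EDGE |
| §10.u060, u061 | pp. 61–62 | tree `dprime`, `dfrak` | OBJECT (cited) |
| §10.u062 | p. 62 | `ffSel_zero`, `ghSel_zero` (PROVED) | PROVED |
| §10.u063 | p. 62, "`𝔡′ ≃ −8ι₃/(0.498π)`" | `dprimeLead`, `dprimeLead_re` (PROVED) | OBJECT (heuristic `≃`, see docstring) |
| §10.u064 | p. 62 | tree `Ineq10a`, `Ineq10b` (certified TRUE: `Section10Certificate.Ineq10a_holds`, `Ineq10b_holds`) | cited |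
| §10.u065 | p. 62, "`𝔶𝔶_{μj}(z) ≃ 0`" | heuristic, no precise printed claim — no decl (`noted`); the quantitative content is u066 | noted |
| §10.u066, u067 | p. 62 | tree `Ineq10c`, `Ineq10d` (certified TRUE: `Ineq10c_holds`, `Ineq10d_holds`); deduction `Skeleton.prop24_of_eval1017` | cited |

Typer's notes (faithfulness flags for the referees, not verdicts). (i) u043 prints
`(−1 − β_j log(y/P^{0.5}))𝔤_{j6}(P^{0.504}/dr)` inside a sum over `n` — typed with `n` for both `y` and
`dr`. (ii) (10.16) prints `… + 3/2 d′₆₃ + d₆₃))` — typed as `3/2(d′₆₃ + d₆₃)` (parenthesis slip; the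
tree's `dfrak` reads it the same way). (iii) "with simple modification, Lemma 10.1 and 10.2 apply to"
the shifted sums (u032/u033) prints no statement: `Lemma101S`/`Lemma102S` are the SUBSTITUTION
reading `y ↦ yP^{0.004}/(Dt₀)` (for Lemma 10.1 this is literally Lemma 10.1, PROVED edge
`lemma101S_of_lemma101`); the later displays u049/u050/u056/u057 use the thresholds `P^{0.496}`,
`P^{0.498}`, `P^{0.5}` for `dr` itself and `𝔶(P^{0.004}dr)`, which differ from the substitution by the
factor `Dt₀ = P^{α̃}`, `α̃ → 0` (inside the `T`-windows and the printed `O(𝓛⁻⁸)`). (iv) "the sum over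
`P^{0.502} < dr ≤ P^{0.504}`" (prose before u044) vs `P^{0.502} ≤ n < P^{0.504}` (display): the display
is typed. (v) `o(1)` in u040/u045/u051/u058 is typed literally (`≤ ε`); composing the displayed
`o(α)` steps with u039 gives `o(α)·𝔞`-sized errors, so the literal reading silently uses `𝔞 ≪ 1`
besides Lemma 5.7's `𝔞 ≫ 1` — recorded, not adjudicated. (vi) Lower-case `p^{0.496}`, `p^{0.498}`
in u056/u057 are `P`. Main-order algebra of every `∫dx/x → ∫dz` passage and of every "gathering"
step is kernel-checked in the tree's `Section10MainTerms` (`S1113_eq_d3F`, `S1321_eq_d4F`,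
`S1422_eq_d5F`, `S1214_eq_d6F`, `yfrak*_main`), which this file does not restate.

## References
* Y. Zhang, arXiv:2211.02515v1 (2022), §10 pp. 56–62. [cite: Zhang2022LandauSiegel, §10]
-/

noncomputable section

open Complex Real ComplexConjugate
open Literature.NumberTheory.LFunctions.Zhang2022.Skeleton

namespace Literature.NumberTheory.LFunctions.Zhang2022.Typed.Sec10B

/-! ## `j`-indexed selectors for the tree's printed profiles and constants -/

/-- `𝔣𝔣_{jμ}` (`μ = 6, 7`; (8.13)–(8.18)) selected by `j ∈ {1,2,3}` from the tree's `ff16 … ff37`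
(`j ∉ {1,2}` is sent to `j = 3`, `μ ≠ 7` to `μ = 6`). [cite: Zhang2022LandauSiegel, §8 (8.13)–(8.18) p. 47] -/
def ffSel (j μ : ℕ) : ℝ → ℂ :=
  if μ = 7 then (if j = 1 then ff17 else if j = 2 then ff27 else ff37)
  else (if j = 1 then ff16 else if j = 2 then ff26 else ff36)

/-- `𝔤𝔥_{jμ}` (`μ = 6, 7`; (8.13)–(8.18)) selected by `j` from the tree's `gh16 … gh37`.
[cite: Zhang2022LandauSiegel, §8 (8.13)–(8.18) p. 47] -/
def ghSel (j μ : ℕ) : ℝ → ℂ :=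
  if μ = 7 then (if j = 1 then gh17 else if j = 2 then gh27 else gh37)
  else (if j = 1 then gh16 else if j = 2 then gh26 else gh36)

/-- `𝔶𝔶₁ⱼ` selected by `j` from the tree's `yy11, yy12, yy13` (node §10.u027/u029 for `j = 2, 3`).
[cite: Zhang2022LandauSiegel, §10 p. 56] -/
def yy1Sel (j : ℕ) : ℝ → ℂ := if j = 1 then yy11 else if j = 2 then yy12 else yy13

/-- `𝔶𝔶₂ⱼ` selected by `j` from the tree's `yy21, yy22, yy23` (node §10.u028/u030 for `j = 2, 3`).
[cite: Zhang2022LandauSiegel, §10 p. 56] -/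
def yy2Sel (j : ℕ) : ℝ → ℂ := if j = 1 then yy21 else if j = 2 then yy22 else yy23

/-- `d₃ⱼ` (display before (10.12), node §10.u041) = the tree's `d31, d32, d33`.
[cite: Zhang2022LandauSiegel, §10 p. 58] -/
def d3Sel (j : ℕ) : ℂ := if j = 1 then d31 else if j = 2 then d32 else d33

/-- `d₄ⱼ` (display before (10.13), node §10.u046) = the tree's `d41, d42, d43`.
[cite: Zhang2022LandauSiegel, §10 p. 59] -/
def d4Sel (j : ℕ) : ℂ := if j = 1 then d41 else if j = 2 then d42 else d43

/-- `d′₅ⱼ` (node §10.u052) = the tree's `d5p1, d5p2, d5p3`. [cite: Zhang2022LandauSiegel, §10 p. 60] -/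
def d5pSel (j : ℕ) : ℂ := if j = 1 then d5p1 else if j = 2 then d5p2 else d5p3

/-- `d₅ⱼ` (node §10.u053) = the tree's `d51, d52, d53`. [cite: Zhang2022LandauSiegel, §10 p. 60] -/
def d5Sel (j : ℕ) : ℂ := if j = 1 then d51 else if j = 2 then d52 else d53

/-- `d′₆ⱼ` ((10.15)) = the tree's `d6p1, d6p2, d6p3`. [cite: Zhang2022LandauSiegel, §10 (10.15) p. 61] -/
def d6pSel (j : ℕ) : ℂ := if j = 1 then d6p1 else if j = 2 then d6p2 else d6p3

/-- `d₆ⱼ` (display after (10.15), node §10.u059) = the tree's `d61, d62, d63`.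
[cite: Zhang2022LandauSiegel, §10 p. 61] -/
def d6Sel (j : ℕ) : ℂ := if j = 1 then d61 else if j = 2 then d62 else d63

/-- The printed coefficient `11 − 6j + j²` (`= 6, 3, 2` for `j = 1, 2, 3`), as a complex number
(no `ℕ`-subtraction). [cite: Zhang2022LandauSiegel, §10 p. 58] -/
def nQuad (j : ℕ) : ℂ := (11 : ℂ) - 6 * j + (j : ℂ) ^ 2

/-- Node §10.u062 (p. 62): "For `μ = 6, 7`, `𝔣𝔣_{jμ}(0) = 1`" — holds for the printed profiles.
[cite: Zhang2022LandauSiegel, §10 p. 62] -/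
theorem ffSel_zero (j μ : ℕ) : ffSel j μ 0 = 1 := by
  unfold ffSel ff16 ff26 ff36 ff17 ff27 ff37 ffF
  split_ifs <;> simp

/-- Node §10.u062 (p. 62): "For `μ = 6, 7`, `𝔤𝔥_{jμ}(0) = 1`" — holds for the printed profiles
(`r₀ + r₁ = 1` in each of (8.13)–(8.18)). [cite: Zhang2022LandauSiegel, §10 p. 62] -/
theorem ghSel_zero (j μ : ℕ) : ghSel j μ 0 = 1 := by
  unfold ghSel gh16 gh26 gh36 gh17 gh27 gh37 ghF
  split_ifs <;> norm_num

/-- Node §10.u063 (p. 62): the printed leading-order value "`𝔡′ ≃ −8ι₃/(0.498π)`" of `𝔡′` — what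
`dprime` becomes on replacing `𝔣𝔣_{j6}`, `𝔤𝔥_{j6}` by their value `1` at `0` on `[0, 0.002]`
(`(½ + 2 + 3/2)·2·(−ι₃/(0.498π))`), written `(−8/(0.498π))·ι₃` with the real coefficient first. An
OBJECT recording the heuristic `≃` (no precise printed claim); the quantitative claim is the tree's
`Ineq10a` (u064). [cite: Zhang2022LandauSiegel, §10 p. 62] -/
def dprimeLead : ℂ := ((-(8 / (0.498 * π)) : ℝ) : ℂ) * iota3

/-- The real part of the leading-order value is the `−(8/(0.498π))Re{ι₃}` of the printed
inequality `Re{𝔡′} > −(8/(0.498π))Re{ι₃} − 0.04 > 5.1` (tree `Ineq10a`, `Ineq10b`, node §10.u064).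
[cite: Zhang2022LandauSiegel, §10 p. 62] -/
theorem dprimeLead_re : dprimeLead.re = -(8 / (0.498 * π)) * iota3.re := by
  rw [dprimeLead, Complex.re_ofReal_mul]

/-! ## Objects: the inner sums and the `(d,r)`-sums of the four evaluations -/

section ObjectsD

variable (D : ℕ)

/-- `log P` (`P = exp{𝓛⁹}`, (2.6)). [cite: Zhang2022LandauSiegel, §2 (2.6) p. 4] -/
abbrev logP : ℝ := Real.log (bigP D)

/-- The integrand of the Remark's Mellin formula (node §10.u031, p. 56):
`(Dt₀/P^{0.004})^s ((P₁′)^s − 2(P₂′)^s + (P₃′)^s) y^{−s} s^{−2}`, `P₁′ = P^{0.504}`, `P₂′ = P^{0.502}`,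
`P₃′ = P^{0.5}`. [cite: Zhang2022LandauSiegel, §10 p. 56] -/
def mellinKernelShift (y : ℝ) (s : ℂ) : ℂ :=
  (((D : ℝ) * t0 D / bigP D ^ (0.004 : ℝ) : ℝ) : ℂ) ^ s *
    ((((bigP D ^ (0.504 : ℝ) : ℝ)) : ℂ) ^ s - 2 * (((bigP D ^ (0.502 : ℝ) : ℝ)) : ℂ) ^ s +
      (((bigP D ^ (0.5 : ℝ) : ℝ)) : ℂ) ^ s) / ((y : ℂ) ^ s) / s ^ 2

/-- The substituted argument `y* = yP^{0.004}/(Dt₀)` of the "simple modification" of Lemmas 10.1–10.2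
for the shifted `f̃` (`f̃(log y/log P + 0.004 − α̃) = f̃(log y*/log P)`, `α̃ = log(Dt₀)/log P` (2.30)).
[cite: Zhang2022LandauSiegel, §10 p. 57] -/
def yShift (y : ℝ) : ℝ := y * bigP D ^ (0.004 : ℝ) / (D * t0 D)

end ObjectsD

section ObjectsChi

variable (c' : ℝ) {D : ℕ} (χ : DirichletCharacter ℂ D)

/-- Node §10.u032 (p. 57): the shifted sum `Σ_m χ(m)f̃(log(ym)/log P + 0.004 − α̃)m^{−(1−β_j)}`
(same finite `m`-range as `Skeleton.frakv1`). [cite: Zhang2022LandauSiegel, §10 p. 57] -/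
def frakv1S (j : ℕ) (y : ℝ) : ℂ :=
  ∑ m ∈ Finset.Ico 1 ⌈bigP D⌉₊, χ (m : ZMod D) *
    (ftilde (Real.log (y * m) / Real.log (bigP D) + 0.004 - alphaTilde D) : ℂ) /
      (m : ℂ) ^ (1 - betaJ c' D j)

/-- Node §10.u033 (p. 57): the shifted sum `Σ_n χ(n)f̃(log(drn)/log P + 0.004 − α̃)ξ₀ⱼ(n;d,r)n⁻¹`
(same finite `n`-range as `Skeleton.frakv2`). [cite: Zhang2022LandauSiegel, §10 p. 57] -/
def frakv2S (j d r : ℕ) : ℂ :=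
  ∑ n ∈ Finset.Ico 1 ⌈bigP D⌉₊, χ (n : ZMod D) *
    (ftilde (Real.log ((d * r * n : ℕ) : ℝ) / Real.log (bigP D) + 0.004 - alphaTilde D) : ℂ) *
      xiZero c' D j n d r / (n : ℂ)

/-- The `m`-sum of `S_j(𝐚₁₁,𝐚₁₃)` (node §10.u034, p. 57) at `y = dr`:
`Σ_m χ(m)(ϰ₁(ym) + ι₂ϰ₂(ym))m^{−(1−β_j)}` (truncated at `⌈PT⁻²⌉` like `Skeleton.Sj`).
[cite: Zhang2022LandauSiegel, §10 p. 57] -/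
def mSum11 (j y : ℕ) : ℂ :=
  ∑ m ∈ Finset.Ico 1 (Nsupp D), χ (m : ZMod D) * (vk1 D (y * m) + iota2 * vk2 D (y * m)) /
    (m : ℂ) ^ (1 - betaJ c' D j)

/-- The `n`-sum of `S_j(𝐚₁₁,𝐚₁₃)` (node §10.u034, p. 57): `Σ_n χ(n)f̃(log(drn)/log P)ξ₀ⱼ(n;d,r)n⁻¹`
(= `𝔳₂ⱼ(d,r)` of Lemma 10.2 up to the truncation). [cite: Zhang2022LandauSiegel, §10 p. 57] -/
def nSum13 (j d r : ℕ) : ℂ :=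
  ∑ n ∈ Finset.Ico 1 (Nsupp D), χ (n : ZMod D) *
    (ftilde (Real.log ((d * r * n : ℕ) : ℝ) / Real.log (bigP D)) : ℂ) * xiZero c' D j n d r / (n : ℂ)

/-- The `m`-sum of `S_j(𝐚₁₃,𝐚₂₁)` (node §10.u042, p. 58) at `y = dr`:
`Σ_m χ(m)f̃(log(ym)/log P)m^{−(1−β_j)}` (= `𝔳₁ⱼ(y)` of Lemma 10.1 up to the truncation).
[cite: Zhang2022LandauSiegel, §10 p. 58] -/
def mSum13 (j y : ℕ) : ℂ :=
  ∑ m ∈ Finset.Ico 1 (Nsupp D), χ (m : ZMod D) *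
    (ftilde (Real.log ((y * m : ℕ) : ℝ) / Real.log (bigP D)) : ℂ) / (m : ℂ) ^ (1 - betaJ c' D j)

/-- The `n`-sum of `S_j(𝐚₁₃,𝐚₂₁)` (node §10.u042, p. 58):
`Σ_n χ(n)(conj ϰ₁(drn) + ῑ₂ conj ϰ₂(drn))ξ₀ⱼ(n;d,r)n⁻¹`. [cite: Zhang2022LandauSiegel, §10 p. 58] -/
def nSum21 (j d r : ℕ) : ℂ :=
  ∑ n ∈ Finset.Ico 1 (Nsupp D), χ (n : ZMod D) *
    (conj (vk1 D (d * r * n)) + conj iota2 * conj (vk2 D (d * r * n))) * xiZero c' D j n d r / (n : ℂ)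

/-- The `m`-sum of `S_j(𝐚₁₄,𝐚₂₂)` (node §10.u047, p. 59) at `y = dr`:
`Σ_m χ(m)f̃(log(ym)/log P + 0.004 − α̃)m^{−(1−β_j)}`. [cite: Zhang2022LandauSiegel, §10 p. 59] -/
def mSum14 (j y : ℕ) : ℂ :=
  ∑ m ∈ Finset.Ico 1 (Nsupp D), χ (m : ZMod D) *
    (ftilde (Real.log ((y * m : ℕ) : ℝ) / Real.log (bigP D) + 0.004 - alphaTilde D) : ℂ) /
      (m : ℂ) ^ (1 - betaJ c' D j)

/-- The `n`-sum of `S_j(𝐚₁₄,𝐚₂₂)` (node §10.u047, p. 59):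
`Σ_n χ(n)(ι₃ conj ϰ₃(drn) + ι₄ conj ϰ₂(drn))ξ₀ⱼ(n;d,r)n⁻¹`. [cite: Zhang2022LandauSiegel, §10 p. 59] -/
def nSum22 (j d r : ℕ) : ℂ :=
  ∑ n ∈ Finset.Ico 1 (Nsupp D), χ (n : ZMod D) *
    (iota3 * conj (vk3 D (d * r * n)) + iota4 * conj (vk2 D (d * r * n))) * xiZero c' D j n d r /
      (n : ℂ)

/-- The `m`-sum of `S_j(𝐚₁₂,𝐚₁₄)` (node §10.u054, p. 60) at `y = dr`:
`Σ_m χ(m)(ῑ₃ϰ₃(ym) + ῑ₄ϰ₂(ym))m^{−(1−β_j)}`. [cite: Zhang2022LandauSiegel, §10 p. 60] -/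
def mSum12 (j y : ℕ) : ℂ :=
  ∑ m ∈ Finset.Ico 1 (Nsupp D), χ (m : ZMod D) *
    (conj iota3 * vk3 D (y * m) + conj iota4 * vk2 D (y * m)) / (m : ℂ) ^ (1 - betaJ c' D j)

/-- The `n`-sum of `S_j(𝐚₁₂,𝐚₁₄)` (node §10.u054, p. 60):
`Σ_n χ(n)f̃(log(drn)/log P + 0.004 − α̃)ξ₀ⱼ(n;d,r)n⁻¹`. [cite: Zhang2022LandauSiegel, §10 p. 60] -/
def nSum14 (j d r : ℕ) : ℂ :=
  ∑ n ∈ Finset.Ico 1 (Nsupp D), χ (n : ZMod D) *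
    (ftilde (Real.log ((d * r * n : ℕ) : ℝ) / Real.log (bigP D) + 0.004 - alphaTilde D) : ℂ) *
      xiZero c' D j n d r / (n : ℂ)

/-- The printed weight `|χ(d)||μχ(r)|λ₀ⱼ(dr)/(drφ(r))` of the `(d,r)`-sums of §10 (nodes u034,
u042, u047, u054). [cite: Zhang2022LandauSiegel, §10 p. 57] -/
def drWeight (j d r : ℕ) : ℂ :=
  (‖χ (d : ZMod D)‖ : ℂ) * (‖((ArithmeticFunction.moebius r : ℤ) : ℂ) * χ (r : ZMod D)‖ : ℂ) *
    lamZero c' D j (d * r) / (((d * r : ℕ) : ℂ) * (Nat.totient r : ℂ))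

/-- The full `(d,r)`-sum `Σ_rΣ_d |χ(d)||μχ(r)|λ₀ⱼ(dr)/(drφ(r)) M(dr) N(d,r)` (right sides of u034,
u042, u047, u054; `d, r` truncated at `⌈PT⁻²⌉` like `Skeleton.Sj`).
[cite: Zhang2022LandauSiegel, §10 p. 57] -/
def drSumAll (j : ℕ) (M : ℕ → ℂ) (N : ℕ → ℕ → ℂ) : ℂ :=
  ∑ d ∈ Finset.Ico 1 (Nsupp D), ∑ r ∈ Finset.Ico 1 (Nsupp D), drWeight c' χ j d r * M (d * r) * N d r

/-- "The right side is split into three sums according to `dr < P^{a}`, …" (nodes u035, u048): the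
part of `drSumAll` with `lo ≤ dr < hi`. [cite: Zhang2022LandauSiegel, §10 p. 57] -/
def drSum (j : ℕ) (M : ℕ → ℂ) (N : ℕ → ℕ → ℂ) (lo hi : ℝ) : ℂ :=
  ∑ d ∈ Finset.Ico 1 (Nsupp D), ∑ r ∈ Finset.Ico 1 (Nsupp D),
    if lo ≤ ((d * r : ℕ) : ℝ) ∧ ((d * r : ℕ) : ℝ) < hi then drWeight c' χ j d r * M (d * r) * N d r
    else 0

/-- The collapsed single sums of §10: `Σ_{lo ≤ n < hi} |χ(n)|λ₀ⱼ(n)φ(n)⁻¹ g(n)` (printed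
`Σ_{n<P^{0.5}}`, `Σ_{P^{0.5}≤n<P^{0.502}}`, …; `n ≥ 1`). [cite: Zhang2022LandauSiegel, §10 p. 57] -/
def nAvg (j : ℕ) (lo hi : ℝ) (g : ℕ → ℂ) : ℂ :=
  ∑ n ∈ (Finset.Ico 1 ⌈hi⌉₊).filter (fun n : ℕ => lo ≤ (n : ℝ)),
    (‖χ (n : ZMod D)‖ : ℂ) * lamZero c' D j n / (Nat.totient n : ℂ) * g n

end ObjectsChi

/-! ## p. 56–57: the Remark (Mellin formula for the shifted `f̃`) and the shifted Lemmas 10.1–10.2 -/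

section Claims

variable (c' : ℝ)

/-- **Node §10.u031** (Remark, p. 56): "Similar to (10.6),
`f̃(log y/log P + 0.004 − α̃) = (500/log P)·(1/2πi)∫_{(1)} (Dt₀/P^{0.004})^s ((P₁′)^s − 2(P₂′)^s + (P₃′)^s) y^{−s} ds/s²`"
(`s = 1 + it`, `ds = i dt`). CLAIM (an exact identity for `y > 0`).
[cite: Zhang2022LandauSiegel, §10 Remark p. 56] -/
def RemarkMellinShift : Prop :=
  ForAllLarge fun D _ _ => ∀ y : ℝ, 0 < y →
    ((ftilde (Real.log y / Real.log (bigP D) + 0.004 - alphaTilde D) : ℝ) : ℂ) =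
      500 / (Real.log (bigP D) : ℂ) * (1 / (2 * π) : ℂ) *
        ∫ t : ℝ, mellinKernelShift D y (1 + t * I)

/-- **Nodes §10.u032–u033, Lemma 10.1 part** (p. 57): "with simple modification, Lemma 10.1 [applies]
to" `frakv1S` — SUBSTITUTION READING: Lemma 10.1 ((10.2)–(10.5)) for the shifted sum at
`y* = yP^{0.004}/(Dt₀)` (the manuscript prints no statement; see the module docstring, note (iii)).
CLAIM; implied by `Skeleton.Lemma101` (`lemma101S_of_lemma101`). [cite: Zhang2022LandauSiegel, §10 p. 57] -/
def Lemma101S : Prop :=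
  ∃ c : ℝ, 0 < c ∧ ∃ C : ℝ, ForAllLarge fun D _ χ => AssumptionA D χ →
    ∀ j ∈ ({1, 2, 3} : Finset ℕ), ∀ y : ℝ,
      (1 ≤ yShift D y → yShift D y ≤ bigP D ^ (0.5 : ℝ) / bigT D →
        ‖frakv1S c' χ j y‖ ≤ C * bigT D ^ (-c)) ∧
      (bigP D ^ (0.5 : ℝ) < yShift D y → yShift D y ≤ bigP D ^ (0.502 : ℝ) / bigT D →
        ‖frakv1S c' χ j y - 500 * deriv χ.LFunction 1 / Real.log (bigP D) *
          (-1 - betaJ c' D j * (Real.log (yShift D y / bigP D ^ (0.5 : ℝ)) : ℂ))‖ ≤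
            C * (ell D ^ 15)⁻¹) ∧
      (bigP D ^ (0.502 : ℝ) < yShift D y → yShift D y ≤ bigP D ^ (0.504 : ℝ) / bigT D →
        ‖frakv1S c' χ j y - 500 * deriv χ.LFunction 1 / Real.log (bigP D) *
          (1 - betaJ c' D j * (Real.log (bigP D ^ (0.504 : ℝ) / yShift D y) : ℂ))‖ ≤
            C * (ell D ^ 15)⁻¹) ∧
      ((bigP D ^ (0.5 : ℝ) / bigT D < yShift D y ∧ yShift D y ≤ bigP D ^ (0.5 : ℝ)) ∨
          (bigP D ^ (0.502 : ℝ) / bigT D < yShift D y ∧ yShift D y ≤ bigP D ^ (0.502 : ℝ)) ∨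
          (bigP D ^ (0.504 : ℝ) / bigT D < yShift D y ∧ yShift D y < bigP D ^ (0.504 : ℝ)) →
        ‖frakv1S c' χ j y‖ ≤ C * (ell D ^ 7)⁻¹)

/-- **Nodes §10.u032–u033, Lemma 10.2 part** (p. 57): "with simple modification, Lemma 10.2 [applies]
to" `frakv2S` — SUBSTITUTION READING: (10.8)–(10.11) with `dr` replaced by `y* = drP^{0.004}/(Dt₀)`
in the thresholds and in `𝔶₁ⱼ, 𝔶₂ⱼ` (`Π(d,r)`, `ξ₀ⱼ` unchanged). CLAIM.
[cite: Zhang2022LandauSiegel, §10 p. 57] -/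
def Lemma102S : Prop :=
  ∃ C : ℝ, ForAllLarge fun D _ χ => AssumptionA D χ →
    ∀ j ∈ ({1, 2, 3} : Finset ℕ), ∀ d r : ℕ, 1 ≤ d → 1 ≤ r →
      (yShift D ((d * r : ℕ) : ℝ) ≤ bigP D ^ (0.5 : ℝ) / bigT D →
        ‖frakv2S c' χ j d r - deriv χ.LFunction 1 * PiW χ d r / 500 *
          (betaJ c' D (j + 1) * betaJ c' D (j + 2)) * Real.log (bigP D)‖ ≤ C * (ell D ^ 15)⁻¹) ∧
      (bigP D ^ (0.5 : ℝ) < yShift D ((d * r : ℕ) : ℝ) →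
        yShift D ((d * r : ℕ) : ℝ) ≤ bigP D ^ (0.502 : ℝ) / bigT D →
        ‖frakv2S c' χ j d r - 500 * deriv χ.LFunction 1 * PiW χ d r / Real.log (bigP D) *
          (-1 + fraky1 c' D j (yShift D ((d * r : ℕ) : ℝ)))‖ ≤ C * (ell D ^ 15)⁻¹) ∧
      (bigP D ^ (0.502 : ℝ) < yShift D ((d * r : ℕ) : ℝ) →
        yShift D ((d * r : ℕ) : ℝ) ≤ bigP D ^ (0.504 : ℝ) / bigT D →
        ‖frakv2S c' χ j d r - 500 * deriv χ.LFunction 1 * PiW χ d r / Real.log (bigP D) *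
          (1 + fraky2 c' D j (yShift D ((d * r : ℕ) : ℝ)))‖ ≤ C * (ell D ^ 15)⁻¹) ∧
      ((bigP D ^ (0.5 : ℝ) / bigT D < yShift D ((d * r : ℕ) : ℝ) ∧
            yShift D ((d * r : ℕ) : ℝ) ≤ bigP D ^ (0.5 : ℝ)) ∨
          (bigP D ^ (0.502 : ℝ) / bigT D < yShift D ((d * r : ℕ) : ℝ) ∧
            yShift D ((d * r : ℕ) : ℝ) ≤ bigP D ^ (0.502 : ℝ)) ∨
          (bigP D ^ (0.504 : ℝ) / bigT D < yShift D ((d * r : ℕ) : ℝ) ∧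
            yShift D ((d * r : ℕ) : ℝ) < bigP D ^ (0.504 : ℝ)) →
        ‖frakv2S c' χ j d r‖ ≤ C * (ell D ^ 7)⁻¹)

/-! ## p. 57–58: Evaluation of `Θ₁(𝐚₁₁,𝐚₁₃)` ((10.12)) -/

/-- **Node §10.u034** (p. 57): "We have `S_j(𝐚₁₁,𝐚₁₃) = Σ_rΣ_d |χ(d)||μχ(r)|λ₀ⱼ(dr)/(drφ(r))
(Σ_m χ(m)(ϰ₁(drm) + ι₂ϰ₂(drm))m^{−(1−β_j)})(Σ_n χ(n)f̃(log(drn)/log P)ξ₀ⱼ(n;d,r)n⁻¹)`"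
(an identity for real `χ`). CLAIM. [cite: Zhang2022LandauSiegel, §10 p. 57] -/
def IdSj1113 : Prop :=
  ∀ (D : ℕ) [NeZero D] (χ : DirichletCharacter ℂ D), χ.IsQuadratic → ∀ j : ℕ,
    Sj c' D j (a11 χ) (a13 χ) = drSumAll c' χ j (mSum11 c' χ j) (nSum13 c' χ j)

/-- **Node §10.u035** (p. 57): "The right side is split into three sums according to `dr < P^{0.5}`,
`P^{0.5} ≤ dr < P^{0.502}`, `P^{0.502} ≤ dr < P^{0.504}`" (no other terms: `f̃` vanishes for
`dr ≥ P^{0.504}`). CLAIM. [cite: Zhang2022LandauSiegel, §10 p. 57] -/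
def Split1113 : Prop :=
  ∀ (D : ℕ) [NeZero D] (χ : DirichletCharacter ℂ D) (j : ℕ),
    drSumAll c' χ j (mSum11 c' χ j) (nSum13 c' χ j) =
      drSum c' χ j (mSum11 c' χ j) (nSum13 c' χ j) 0 (bigP D ^ (0.5 : ℝ)) +
        drSum c' χ j (mSum11 c' χ j) (nSum13 c' χ j) (bigP D ^ (0.5 : ℝ)) (bigP D ^ (0.502 : ℝ)) +
        drSum c' χ j (mSum11 c' χ j) (nSum13 c' χ j) (bigP D ^ (0.502 : ℝ)) (bigP D ^ (0.504 : ℝ))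

/-- **Node §10.u036, first line** (p. 57): "By Lemma 10.2 and the results in Section 8, the sum over
`dr < P^{0.5}` is equal to
`(L′(1,χ)²/500)β_{j+1}β_{j+2}Σ_{n<P^{0.5}} |χ(n)|λ₀ⱼ(n)φ(n)⁻¹(𝔣_{j6}(P^{0.504}/n)/0.504 + ι₂𝔣_{j7}(P^{0.5}/n)/0.5) + o(α)`."
CLAIM. [cite: Zhang2022LandauSiegel, §10 p. 57] -/
def Eq1036a : Prop :=
  ∀ ε : ℝ, 0 < ε → ForAllLarge fun D _ χ => AssumptionA D χ → ∀ j ∈ ({1, 2, 3} : Finset ℕ),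
    ‖drSum c' χ j (mSum11 c' χ j) (nSum13 c' χ j) 0 (bigP D ^ (0.5 : ℝ)) -
        deriv χ.LFunction 1 ^ 2 / 500 * (betaJ c' D (j + 1) * betaJ c' D (j + 2)) *
          nAvg c' χ j 0 (bigP D ^ (0.5 : ℝ)) (fun n =>
            frakfW c' D j 6 (bigP D ^ (0.504 : ℝ) / n) / 0.504 +
              iota2 * frakfW c' D j 7 (bigP D ^ (0.5 : ℝ) / n) / 0.5)‖ ≤ ε * alpha D

/-- **Node §10.u036, second line** (p. 57):
"`= (𝔞β_{j+1}β_{j+2}/500)∫_1^{P^{0.5}}(𝔣_{j6}(P^{0.504}/x)/0.504 + ι₂𝔣_{j7}(P^{0.5}/x)/0.5)dx/x + o(α)`".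
CLAIM. [cite: Zhang2022LandauSiegel, §10 p. 57] -/
def Eq1036b : Prop :=
  ∀ ε : ℝ, 0 < ε → ForAllLarge fun D _ χ => AssumptionA D χ → ∀ j ∈ ({1, 2, 3} : Finset ℕ),
    ‖deriv χ.LFunction 1 ^ 2 / 500 * (betaJ c' D (j + 1) * betaJ c' D (j + 2)) *
          nAvg c' χ j 0 (bigP D ^ (0.5 : ℝ)) (fun n =>
            frakfW c' D j 6 (bigP D ^ (0.504 : ℝ) / n) / 0.504 +
              iota2 * frakfW c' D j 7 (bigP D ^ (0.5 : ℝ) / n) / 0.5) -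
        frakA χ * (betaJ c' D (j + 1) * betaJ c' D (j + 2)) / 500 *
          ∫ x in (1 : ℝ)..(bigP D ^ (0.5 : ℝ)),
            (frakfW c' D j 6 (bigP D ^ (0.504 : ℝ) / x) / 0.504 +
              iota2 * frakfW c' D j 7 (bigP D ^ (0.5 : ℝ) / x) / 0.5) / (x : ℂ)‖ ≤ ε * alpha D

/-- **Node §10.u036, third line** (p. 57):
"`= (𝔞β_{j+1}β_{j+2}log P/500)∫_0^{0.5}(𝔣𝔣_{j6}(0.004 + z)/0.504 + ι₂𝔣𝔣_{j7}(z)/0.5)dz + o(α)`"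
(substitution `x = P^{0.5−z}`; main-order algebra in tree `Section10MainTerms`). CLAIM.
[cite: Zhang2022LandauSiegel, §10 p. 57] -/
def Eq1036c : Prop :=
  ∀ ε : ℝ, 0 < ε → ForAllLarge fun D _ χ => AssumptionA D χ → ∀ j ∈ ({1, 2, 3} : Finset ℕ),
    ‖frakA χ * (betaJ c' D (j + 1) * betaJ c' D (j + 2)) / 500 *
          (∫ x in (1 : ℝ)..(bigP D ^ (0.5 : ℝ)),
            (frakfW c' D j 6 (bigP D ^ (0.504 : ℝ) / x) / 0.504 +
              iota2 * frakfW c' D j 7 (bigP D ^ (0.5 : ℝ) / x) / 0.5) / (x : ℂ)) -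
        frakA χ * (betaJ c' D (j + 1) * betaJ c' D (j + 2)) * logP D / 500 *
          ∫ z in (0 : ℝ)..0.5, (ffSel j 6 (0.004 + z) / 0.504 + iota2 * ffSel j 7 z / 0.5)‖
      ≤ ε * alpha D

/-- **Node §10.u037, first line** (p. 57): "the sum over `P^{0.5} ≤ dr < P^{0.502}` is equal to
`(500L′(1,χ)²/(0.504 log²P))Σ_{P^{0.5}≤n<P^{0.502}} |χ(n)|λ₀ⱼ(n)φ(n)⁻¹𝔣_{j6}(P^{0.504}/n)(−1 + 𝔶₁ⱼ(n)) + o(α)`."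
CLAIM. [cite: Zhang2022LandauSiegel, §10 p. 57] -/
def Eq1037a : Prop :=
  ∀ ε : ℝ, 0 < ε → ForAllLarge fun D _ χ => AssumptionA D χ → ∀ j ∈ ({1, 2, 3} : Finset ℕ),
    ‖drSum c' χ j (mSum11 c' χ j) (nSum13 c' χ j) (bigP D ^ (0.5 : ℝ)) (bigP D ^ (0.502 : ℝ)) -
        500 * deriv χ.LFunction 1 ^ 2 / (0.504 * logP D ^ 2) *
          nAvg c' χ j (bigP D ^ (0.5 : ℝ)) (bigP D ^ (0.502 : ℝ)) (fun n =>
            frakfW c' D j 6 (bigP D ^ (0.504 : ℝ) / n) * (-1 + fraky1 c' D j n))‖ ≤ ε * alpha D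

/-- **Node §10.u037, second line** (p. 57):
"`= (500𝔞/(0.504 log P))∫_{0.5}^{0.502} 𝔣𝔣_{j6}(0.504 − z)(−1 + 𝔶𝔶₁ⱼ(z))dz + o(α)`". CLAIM.
[cite: Zhang2022LandauSiegel, §10 p. 57] -/
def Eq1037b : Prop :=
  ∀ ε : ℝ, 0 < ε → ForAllLarge fun D _ χ => AssumptionA D χ → ∀ j ∈ ({1, 2, 3} : Finset ℕ),
    ‖500 * deriv χ.LFunction 1 ^ 2 / (0.504 * logP D ^ 2) *
          nAvg c' χ j (bigP D ^ (0.5 : ℝ)) (bigP D ^ (0.502 : ℝ)) (fun n =>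
            frakfW c' D j 6 (bigP D ^ (0.504 : ℝ) / n) * (-1 + fraky1 c' D j n)) -
        500 * frakA χ / (0.504 * logP D) *
          ∫ z in (0.5 : ℝ)..0.502, ffSel j 6 (0.504 - z) * (-1 + yy1Sel j z)‖ ≤ ε * alpha D

/-- **Node §10.u038, first line** (p. 57): "the sum over `P^{0.502} ≤ dr < P^{0.504}` is equal to
`(500L′(1,χ)²/(0.504 log²P))Σ_{P^{0.502}≤n<P^{0.504}} |χ(n)|λ₀ⱼ(n)φ(n)⁻¹𝔣_{j6}(P^{0.504}/n)(1 + 𝔶₂ⱼ(n)) + o(α)`."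
CLAIM. [cite: Zhang2022LandauSiegel, §10 p. 57] -/
def Eq1038a : Prop :=
  ∀ ε : ℝ, 0 < ε → ForAllLarge fun D _ χ => AssumptionA D χ → ∀ j ∈ ({1, 2, 3} : Finset ℕ),
    ‖drSum c' χ j (mSum11 c' χ j) (nSum13 c' χ j) (bigP D ^ (0.502 : ℝ)) (bigP D ^ (0.504 : ℝ)) -
        500 * deriv χ.LFunction 1 ^ 2 / (0.504 * logP D ^ 2) *
          nAvg c' χ j (bigP D ^ (0.502 : ℝ)) (bigP D ^ (0.504 : ℝ)) (fun n =>
            frakfW c' D j 6 (bigP D ^ (0.504 : ℝ) / n) * (1 + fraky2 c' D j n))‖ ≤ ε * alpha D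

/-- **Node §10.u038, second line** (p. 57):
"`= (500𝔞/(0.504 log P))∫_{0.502}^{0.504} 𝔣𝔣_{j6}(0.504 − z)(1 + 𝔶𝔶₂ⱼ(z))dz + o(α)`". CLAIM.
[cite: Zhang2022LandauSiegel, §10 p. 57] -/
def Eq1038b : Prop :=
  ∀ ε : ℝ, 0 < ε → ForAllLarge fun D _ χ => AssumptionA D χ → ∀ j ∈ ({1, 2, 3} : Finset ℕ),
    ‖500 * deriv χ.LFunction 1 ^ 2 / (0.504 * logP D ^ 2) *
          nAvg c' χ j (bigP D ^ (0.502 : ℝ)) (bigP D ^ (0.504 : ℝ)) (fun n =>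
            frakfW c' D j 6 (bigP D ^ (0.504 : ℝ) / n) * (1 + fraky2 c' D j n)) -
        500 * frakA χ / (0.504 * logP D) *
          ∫ z in (0.502 : ℝ)..0.504, ffSel j 6 (0.504 - z) * (1 + yy2Sel j z)‖ ≤ ε * alpha D

/-- **Node §10.u039** (p. 58): "Noting that `β_{j+1}β_{j+2}log P = −(11 − 6j + j²)πα + o(α)`"
(`β₄ = β₁`, `β₅ = β₂`). CLAIM (about the parameters (2.13) only). [cite: Zhang2022LandauSiegel, §10 p. 58] -/
def BetaProd1039 : Prop :=
  ∀ ε : ℝ, 0 < ε → ForAllLarge fun D _ _ => ∀ j ∈ ({1, 2, 3} : Finset ℕ),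
    ‖betaJ c' D (j + 1) * betaJ c' D (j + 2) * logP D + nQuad j * π * alpha D‖ ≤ ε * alpha D

/-- **Node §10.u040** (p. 58): "gathering the above results together we conclude
`α⁻¹S_j(𝐚₁₁,𝐚₁₃) = d₃ⱼ𝔞 + o(1)`" with the printed `d₃ⱼ` (node u041 = tree `d3F`, `d31, d32, d33`).
Typed literally (`≤ ε`); see the module docstring, note (v), on `o(1)` vs `o(𝔞)`. CLAIM.
[cite: Zhang2022LandauSiegel, §10 p. 58] -/
def Concl1113 : Prop :=
  ∀ ε : ℝ, 0 < ε → ForAllLarge fun D _ χ => AssumptionA D χ → ∀ j ∈ ({1, 2, 3} : Finset ℕ),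
    ‖Sj c' D j (a11 χ) (a13 χ) / alpha D - d3Sel j * frakA χ‖ ≤ ε

/-- **(10.12)** (p. 58): "Hence, by Proposition 7.1,
`Θ₁(𝐚₁₁,𝐚₁₃) = (½d₃₁ + 2d₃₂ + 3/2 d₃₃)𝔞𝔓 + o(𝔓)`." CLAIM. [cite: Zhang2022LandauSiegel, §10 (10.12) p. 58] -/
def Eq1012 : Prop :=
  ∀ ε : ℝ, 0 < ε → ForAllLarge fun D _ χ => AssumptionA D χ →
    ‖Theta1 c' χ (a11 χ) (a13 χ) - (1 / 2 * d31 + 2 * d32 + 3 / 2 * d33) * frakA χ * frakP D‖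
      ≤ ε * frakP D

/-! ## p. 58–59: Evaluation of `Θ₁(𝐚₁₃,𝐚₂₁)` ((10.13)) -/

/-- **Node §10.u042** (p. 58): "`S_j(𝐚₁₃,𝐚₂₁) = Σ_rΣ_d |χ(d)||μχ(r)|λ₀ⱼ(dr)/(drφ(r))
(Σ_m χ(m)f̃(log(drm)/log P)m^{−(1−β_j)})(Σ_n χ(n)(conj ϰ₁(drn) + ῑ₂ conj ϰ₂(drn))ξ₀ⱼ(n;d,r)n⁻¹)`"
(identity for real `χ`). CLAIM. [cite: Zhang2022LandauSiegel, §10 p. 58] -/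
def IdSj1321 : Prop :=
  ∀ (D : ℕ) [NeZero D] (χ : DirichletCharacter ℂ D), χ.IsQuadratic → ∀ j : ℕ,
    Sj c' D j (a13 χ) (a21 χ) = drSumAll c' χ j (mSum13 c' χ j) (nSum21 c' χ j)

/-- **Proof of (10.13), split** (p. 58): "The right side is split into three sums in the same way as
in the last subsection" (`dr < P^{0.5}`, `P^{0.5} ≤ dr < P^{0.502}`, `P^{0.502} ≤ dr < P^{0.504}`;
no other terms). CLAIM. [cite: Zhang2022LandauSiegel, §10 p. 58] -/
def Split1321 : Prop :=
  ∀ (D : ℕ) [NeZero D] (χ : DirichletCharacter ℂ D) (j : ℕ),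
    drSumAll c' χ j (mSum13 c' χ j) (nSum21 c' χ j) =
      drSum c' χ j (mSum13 c' χ j) (nSum21 c' χ j) 0 (bigP D ^ (0.5 : ℝ)) +
        drSum c' χ j (mSum13 c' χ j) (nSum21 c' χ j) (bigP D ^ (0.5 : ℝ)) (bigP D ^ (0.502 : ℝ)) +
        drSum c' χ j (mSum13 c' χ j) (nSum21 c' χ j) (bigP D ^ (0.502 : ℝ)) (bigP D ^ (0.504 : ℝ))

/-- **Proof of (10.13), first range** (p. 58): "By Lemma 10.1 and the results in Section 8, the sum
over `dr < P^{0.5}` is `o(α)`." CLAIM. [cite: Zhang2022LandauSiegel, §10 p. 58] -/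
def Small1321 : Prop :=
  ∀ ε : ℝ, 0 < ε → ForAllLarge fun D _ χ => AssumptionA D χ → ∀ j ∈ ({1, 2, 3} : Finset ℕ),
    ‖drSum c' χ j (mSum13 c' χ j) (nSum21 c' χ j) 0 (bigP D ^ (0.5 : ℝ))‖ ≤ ε * alpha D

/-- **Node §10.u043, first line** (p. 58): "the sum over `P^{0.5} ≤ dr < P^{0.502}` is equal to
`(500L′(1,χ)²/(0.504 log²P))Σ_{P^{0.5}≤n<P^{0.502}} |χ(n)|λ₀ⱼ(n)φ(n)⁻¹(−1 − β_j log(y/P^{0.5}))𝔤_{j6}(P^{0.504}/dr) + o(α)`"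
— printed with `y` and `dr` inside an `n`-sum; typed with `n` for both (note (i)). CLAIM.
[cite: Zhang2022LandauSiegel, §10 p. 58] -/
def Eq1043a : Prop :=
  ∀ ε : ℝ, 0 < ε → ForAllLarge fun D _ χ => AssumptionA D χ → ∀ j ∈ ({1, 2, 3} : Finset ℕ),
    ‖drSum c' χ j (mSum13 c' χ j) (nSum21 c' χ j) (bigP D ^ (0.5 : ℝ)) (bigP D ^ (0.502 : ℝ)) -
        500 * deriv χ.LFunction 1 ^ 2 / (0.504 * logP D ^ 2) *
          nAvg c' χ j (bigP D ^ (0.5 : ℝ)) (bigP D ^ (0.502 : ℝ)) (fun n =>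
            (-1 - betaJ c' D j * (Real.log (n / bigP D ^ (0.5 : ℝ)) : ℂ)) *
              frakgW c' D j 6 (bigP D ^ (0.504 : ℝ) / n))‖ ≤ ε * alpha D

/-- **Node §10.u043, second line** (p. 58):
"`= (500𝔞/(0.504 log P))∫_{0.5}^{0.502}(−1 − πij(z − 0.5))𝔤𝔥_{j6}(0.504 − z)dz + o(α)`". CLAIM.
[cite: Zhang2022LandauSiegel, §10 p. 58] -/
def Eq1043b : Prop :=
  ∀ ε : ℝ, 0 < ε → ForAllLarge fun D _ χ => AssumptionA D χ → ∀ j ∈ ({1, 2, 3} : Finset ℕ),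
    ‖500 * deriv χ.LFunction 1 ^ 2 / (0.504 * logP D ^ 2) *
          nAvg c' χ j (bigP D ^ (0.5 : ℝ)) (bigP D ^ (0.502 : ℝ)) (fun n =>
            (-1 - betaJ c' D j * (Real.log (n / bigP D ^ (0.5 : ℝ)) : ℂ)) *
              frakgW c' D j 6 (bigP D ^ (0.504 : ℝ) / n)) -
        500 * frakA χ / (0.504 * logP D) *
          ∫ z in (0.5 : ℝ)..0.502, (-1 - π * I * j * (z - 0.5)) * ghSel j 6 (0.504 - z)‖
      ≤ ε * alpha D

/-- **Node §10.u044, first line** (p. 58): "the sum over `P^{0.502} < dr ≤ P^{0.504}` [display: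
`P^{0.502} ≤ n < P^{0.504}`] is equal to
`(500L′(1,χ)²/(0.504 log²P))Σ_{P^{0.502}≤n<P^{0.504}} |χ(n)|λ₀ⱼ(n)φ(n)⁻¹(1 − β_j log(P^{0.504}/n))𝔤_{j6}(P^{0.504}/n) + o(α)`."
CLAIM. [cite: Zhang2022LandauSiegel, §10 p. 58] -/
def Eq1044a : Prop :=
  ∀ ε : ℝ, 0 < ε → ForAllLarge fun D _ χ => AssumptionA D χ → ∀ j ∈ ({1, 2, 3} : Finset ℕ),
    ‖drSum c' χ j (mSum13 c' χ j) (nSum21 c' χ j) (bigP D ^ (0.502 : ℝ)) (bigP D ^ (0.504 : ℝ)) -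
        500 * deriv χ.LFunction 1 ^ 2 / (0.504 * logP D ^ 2) *
          nAvg c' χ j (bigP D ^ (0.502 : ℝ)) (bigP D ^ (0.504 : ℝ)) (fun n =>
            (1 - betaJ c' D j * (Real.log (bigP D ^ (0.504 : ℝ) / n) : ℂ)) *
              frakgW c' D j 6 (bigP D ^ (0.504 : ℝ) / n))‖ ≤ ε * alpha D

/-- **Node §10.u044, second line** (p. 58):
"`= (500𝔞/(0.504 log P))∫_{0.502}^{0.504}(1 − πij(0.504 − z))𝔤𝔥_{j6}(0.504 − z)dz + o(α)`". CLAIM.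
[cite: Zhang2022LandauSiegel, §10 p. 58] -/
def Eq1044b : Prop :=
  ∀ ε : ℝ, 0 < ε → ForAllLarge fun D _ χ => AssumptionA D χ → ∀ j ∈ ({1, 2, 3} : Finset ℕ),
    ‖500 * deriv χ.LFunction 1 ^ 2 / (0.504 * logP D ^ 2) *
          nAvg c' χ j (bigP D ^ (0.502 : ℝ)) (bigP D ^ (0.504 : ℝ)) (fun n =>
            (1 - betaJ c' D j * (Real.log (bigP D ^ (0.504 : ℝ) / n) : ℂ)) *
              frakgW c' D j 6 (bigP D ^ (0.504 : ℝ) / n)) -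
        500 * frakA χ / (0.504 * logP D) *
          ∫ z in (0.502 : ℝ)..0.504, (1 - π * I * j * (0.504 - z)) * ghSel j 6 (0.504 - z)‖
      ≤ ε * alpha D

/-- **Node §10.u045** (p. 59): "Gathering these results together we conclude
`α⁻¹S_j(𝐚₁₃,𝐚₂₁) = d₄ⱼ𝔞 + o(1)`" with the printed `d₄ⱼ` (node u046 = tree `d4F`, `d41, d42, d43`).
CLAIM (literal `o(1)`, note (v)). [cite: Zhang2022LandauSiegel, §10 p. 59] -/
def Concl1321 : Prop :=
  ∀ ε : ℝ, 0 < ε → ForAllLarge fun D _ χ => AssumptionA D χ → ∀ j ∈ ({1, 2, 3} : Finset ℕ),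
    ‖Sj c' D j (a13 χ) (a21 χ) / alpha D - d4Sel j * frakA χ‖ ≤ ε

/-- **(10.13)** (p. 59): "Hence, by Proposition 7.1,
`Θ₁(𝐚₁₃,𝐚₂₁) = (½d₄₁ + 2d₄₂ + 3/2 d₄₃)𝔞𝔓 + o(𝔓)`." CLAIM. [cite: Zhang2022LandauSiegel, §10 (10.13) p. 59] -/
def Eq1013 : Prop :=
  ∀ ε : ℝ, 0 < ε → ForAllLarge fun D _ χ => AssumptionA D χ →
    ‖Theta1 c' χ (a13 χ) (a21 χ) - (1 / 2 * d41 + 2 * d42 + 3 / 2 * d43) * frakA χ * frakP D‖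
      ≤ ε * frakP D

/-! ## p. 59–60: Evaluation of `Θ₁(𝐚₁₄,𝐚₂₂)` ((10.14)) -/

/-- **Node §10.u047** (p. 59): "`S_j(𝐚₁₄,𝐚₂₂) = Σ_rΣ_d |χ(d)||μχ(r)|λ₀ⱼ(dr)/(drφ(r))
(Σ_m χ(m)f̃(log(drm)/log P + 0.004 − α̃)m^{−(1−β_j)})(Σ_n χ(n)(ι₃ conj ϰ₃(drn) + ι₄ conj ϰ₂(drn))ξ₀ⱼ(n;d,r)n⁻¹)`"
(identity for real `χ`). CLAIM. [cite: Zhang2022LandauSiegel, §10 p. 59] -/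
def IdSj1422 : Prop :=
  ∀ (D : ℕ) [NeZero D] (χ : DirichletCharacter ℂ D), χ.IsQuadratic → ∀ j : ℕ,
    Sj c' D j (a14 χ) (a22 χ) = drSumAll c' χ j (mSum14 c' χ j) (nSum22 c' χ j)

/-- **Node §10.u048** (p. 59): "The right side is split into three sums according to `dr < P^{0.496}`,
`P^{0.496} ≤ dr < P^{0.498}`, `P^{0.498} ≤ dr < P^{0.5}`" (no other terms: `ϰ₂, ϰ₃` vanish beyond
`P₂ < P₃ < P^{0.5}`). CLAIM. [cite: Zhang2022LandauSiegel, §10 p. 59] -/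
def Split1422 : Prop :=
  ∀ (D : ℕ) [NeZero D] (χ : DirichletCharacter ℂ D) (j : ℕ),
    drSumAll c' χ j (mSum14 c' χ j) (nSum22 c' χ j) =
      drSum c' χ j (mSum14 c' χ j) (nSum22 c' χ j) 0 (bigP D ^ (0.496 : ℝ)) +
        drSum c' χ j (mSum14 c' χ j) (nSum22 c' χ j) (bigP D ^ (0.496 : ℝ)) (bigP D ^ (0.498 : ℝ)) +
        drSum c' χ j (mSum14 c' χ j) (nSum22 c' χ j) (bigP D ^ (0.498 : ℝ)) (bigP D ^ (0.5 : ℝ))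

/-- **Proof of (10.14), first range** (p. 59): "By a result similar to Lemma 10.1 and the results in
Section 8, the sum over `dr < P^{0.496}` is `o(α)`." CLAIM. [cite: Zhang2022LandauSiegel, §10 p. 59] -/
def Small1422 : Prop :=
  ∀ ε : ℝ, 0 < ε → ForAllLarge fun D _ χ => AssumptionA D χ → ∀ j ∈ ({1, 2, 3} : Finset ℕ),
    ‖drSum c' χ j (mSum14 c' χ j) (nSum22 c' χ j) 0 (bigP D ^ (0.496 : ℝ))‖ ≤ ε * alpha D

/-- **Node §10.u049, first line** (p. 59): "the sum over `P^{0.496} ≤ dr < P^{0.498}` is equal to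
`(500L′(1,χ)²/log²P)Σ_{P^{0.496}≤n<P^{0.498}} |χ(n)|λ₀ⱼ(n)φ(n)⁻¹(−1 − β_j log(P^{−0.496}n))
(ι₃𝔤_{j6}(P^{0.498}/n)/0.498 + ι₄𝔤_{j7}(P^{0.5}/n)/0.5) + o(α)`." CLAIM. [cite: Zhang2022LandauSiegel, §10 p. 59] -/
def Eq1049a : Prop :=
  ∀ ε : ℝ, 0 < ε → ForAllLarge fun D _ χ => AssumptionA D χ → ∀ j ∈ ({1, 2, 3} : Finset ℕ),
    ‖drSum c' χ j (mSum14 c' χ j) (nSum22 c' χ j) (bigP D ^ (0.496 : ℝ)) (bigP D ^ (0.498 : ℝ)) -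
        500 * deriv χ.LFunction 1 ^ 2 / logP D ^ 2 *
          nAvg c' χ j (bigP D ^ (0.496 : ℝ)) (bigP D ^ (0.498 : ℝ)) (fun n =>
            (-1 - betaJ c' D j * (Real.log (bigP D ^ (-0.496 : ℝ) * n) : ℂ)) *
              (iota3 / 0.498 * frakgW c' D j 6 (bigP D ^ (0.498 : ℝ) / n) +
                iota4 / 0.5 * frakgW c' D j 7 (bigP D ^ (0.5 : ℝ) / n)))‖ ≤ ε * alpha D

/-- **Node §10.u049, second line** (pp. 59–60): "`= (500𝔞/log P)∫_{0.496}^{0.498}(−1 − πij(z − 0.496))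
(ι₃𝔤𝔥_{j6}(0.498 − z)/0.498 + ι₄𝔤𝔥_{j7}(0.5 − z)/0.5)dz + o(α)`". CLAIM. [cite: Zhang2022LandauSiegel, §10 p. 59] -/
def Eq1049b : Prop :=
  ∀ ε : ℝ, 0 < ε → ForAllLarge fun D _ χ => AssumptionA D χ → ∀ j ∈ ({1, 2, 3} : Finset ℕ),
    ‖500 * deriv χ.LFunction 1 ^ 2 / logP D ^ 2 *
          nAvg c' χ j (bigP D ^ (0.496 : ℝ)) (bigP D ^ (0.498 : ℝ)) (fun n =>
            (-1 - betaJ c' D j * (Real.log (bigP D ^ (-0.496 : ℝ) * n) : ℂ)) *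
              (iota3 / 0.498 * frakgW c' D j 6 (bigP D ^ (0.498 : ℝ) / n) +
                iota4 / 0.5 * frakgW c' D j 7 (bigP D ^ (0.5 : ℝ) / n))) -
        500 * frakA χ / logP D *
          ∫ z in (0.496 : ℝ)..0.498, (-1 - π * I * j * (z - 0.496)) *
            (iota3 / 0.498 * ghSel j 6 (0.498 - z) + iota4 / 0.5 * ghSel j 7 (0.5 - z))‖
      ≤ ε * alpha D

/-- **Node §10.u050, first line** (p. 60): "the sum over `P^{0.498} ≤ dr < P^{0.5}` is equal to
`(500L′(1,χ)²/log²P)(ι₄/0.5)Σ_{P^{0.498}≤n<P^{0.5}} |χ(n)|λ₀ⱼ(n)φ(n)⁻¹(1 − β_j log(P^{0.5}/n))𝔤_{j7}(P^{0.5}/n) + o(α)`."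
CLAIM. [cite: Zhang2022LandauSiegel, §10 p. 60] -/
def Eq1050a : Prop :=
  ∀ ε : ℝ, 0 < ε → ForAllLarge fun D _ χ => AssumptionA D χ → ∀ j ∈ ({1, 2, 3} : Finset ℕ),
    ‖drSum c' χ j (mSum14 c' χ j) (nSum22 c' χ j) (bigP D ^ (0.498 : ℝ)) (bigP D ^ (0.5 : ℝ)) -
        500 * deriv χ.LFunction 1 ^ 2 / logP D ^ 2 * (iota4 / 0.5) *
          nAvg c' χ j (bigP D ^ (0.498 : ℝ)) (bigP D ^ (0.5 : ℝ)) (fun n =>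
            (1 - betaJ c' D j * (Real.log (bigP D ^ (0.5 : ℝ) / n) : ℂ)) *
              frakgW c' D j 7 (bigP D ^ (0.5 : ℝ) / n))‖ ≤ ε * alpha D

/-- **Node §10.u050, second line** (p. 60):
"`= (1000ι₄𝔞/log P)∫_{0.498}^{0.5}(1 − πij(0.5 − z))𝔤𝔥_{j7}(0.5 − z)dz + o(α)`". CLAIM.
[cite: Zhang2022LandauSiegel, §10 p. 60] -/
def Eq1050b : Prop :=
  ∀ ε : ℝ, 0 < ε → ForAllLarge fun D _ χ => AssumptionA D χ → ∀ j ∈ ({1, 2, 3} : Finset ℕ),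
    ‖500 * deriv χ.LFunction 1 ^ 2 / logP D ^ 2 * (iota4 / 0.5) *
          nAvg c' χ j (bigP D ^ (0.498 : ℝ)) (bigP D ^ (0.5 : ℝ)) (fun n =>
            (1 - betaJ c' D j * (Real.log (bigP D ^ (0.5 : ℝ) / n) : ℂ)) *
              frakgW c' D j 7 (bigP D ^ (0.5 : ℝ) / n)) -
        1000 * iota4 * frakA χ / logP D *
          ∫ z in (0.498 : ℝ)..0.5, (1 - π * I * j * (0.5 - z)) * ghSel j 7 (0.5 - z)‖
      ≤ ε * alpha D

/-- **Node §10.u051** (p. 60): "Gathering the above results together we conclude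
`α⁻¹S_j(𝐚₁₄,𝐚₂₂) = (d′₅ⱼ + d₅ⱼ)𝔞 + o(1)`" with the printed `d′₅ⱼ`, `d₅ⱼ` (nodes u052, u053 = tree
`d5pF`, `d5F`). CLAIM (literal `o(1)`, note (v)). [cite: Zhang2022LandauSiegel, §10 p. 60] -/
def Concl1422 : Prop :=
  ∀ ε : ℝ, 0 < ε → ForAllLarge fun D _ χ => AssumptionA D χ → ∀ j ∈ ({1, 2, 3} : Finset ℕ),
    ‖Sj c' D j (a14 χ) (a22 χ) / alpha D - (d5pSel j + d5Sel j) * frakA χ‖ ≤ ε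

/-- **(10.14)** (p. 60): "Hence, by Proposition 7.1,
`Θ₁(𝐚₁₄,𝐚₂₂) = (½(d′₅₁ + d₅₁) + 2(d′₅₂ + d₅₂) + 3/2(d′₅₃ + d₅₃))𝔞𝔓 + o(𝔓)`." CLAIM.
[cite: Zhang2022LandauSiegel, §10 (10.14) p. 60] -/
def Eq1014 : Prop :=
  ∀ ε : ℝ, 0 < ε → ForAllLarge fun D _ χ => AssumptionA D χ →
    ‖Theta1 c' χ (a14 χ) (a22 χ) -
        (1 / 2 * (d5p1 + d51) + 2 * (d5p2 + d52) + 3 / 2 * (d5p3 + d53)) * frakA χ * frakP D‖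
      ≤ ε * frakP D

/-! ## p. 60–61: Evaluation of `Θ₁(𝐚₁₂,𝐚₁₄)` ((10.15)–(10.16)) -/

/-- **Node §10.u054** (p. 60): "`S_j(𝐚₁₂,𝐚₁₄) = Σ_rΣ_d |χ(d)||μχ(r)|λ₀ⱼ(dr)/(drφ(r))
(Σ_m χ(m)(ῑ₃ϰ₃(drm) + ῑ₄ϰ₂(drm))m^{−(1−β_j)})(Σ_n χ(n)f̃(log(drn)/log P + 0.004 − α̃)ξ₀ⱼ(n;d,r)n⁻¹)`"
(identity for real `χ`). CLAIM. [cite: Zhang2022LandauSiegel, §10 p. 60] -/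
def IdSj1214 : Prop :=
  ∀ (D : ℕ) [NeZero D] (χ : DirichletCharacter ℂ D), χ.IsQuadratic → ∀ j : ℕ,
    Sj c' D j (a12 χ) (a14 χ) = drSumAll c' χ j (mSum12 c' χ j) (nSum14 c' χ j)

/-- **Proof of (10.16), split** (p. 60): "The right side is split into three sums in the same way as
in the last subsection" (`P^{0.496}`, `P^{0.498}`, `P^{0.5}`; no other terms). CLAIM.
[cite: Zhang2022LandauSiegel, §10 p. 60] -/
def Split1214 : Prop :=
  ∀ (D : ℕ) [NeZero D] (χ : DirichletCharacter ℂ D) (j : ℕ),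
    drSumAll c' χ j (mSum12 c' χ j) (nSum14 c' χ j) =
      drSum c' χ j (mSum12 c' χ j) (nSum14 c' χ j) 0 (bigP D ^ (0.496 : ℝ)) +
        drSum c' χ j (mSum12 c' χ j) (nSum14 c' χ j) (bigP D ^ (0.496 : ℝ)) (bigP D ^ (0.498 : ℝ)) +
        drSum c' χ j (mSum12 c' χ j) (nSum14 c' χ j) (bigP D ^ (0.498 : ℝ)) (bigP D ^ (0.5 : ℝ))

/-- **Node §10.u055, first line** (p. 60): "By a result similar to Lemma 10.2 and the results in
Section 8, the sum over `dr < P^{0.496}` is equal to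
`(L′(1,χ)²/500)β_{j+1}β_{j+2}Σ_{n<P^{0.496}} |χ(n)|λ₀ⱼ(n)φ(n)⁻¹(ῑ₃𝔣_{j6}(P^{0.498}/n)/0.498 + ῑ₄𝔣_{j7}(P^{0.5}/n)/0.5) + o(α)`."
CLAIM. [cite: Zhang2022LandauSiegel, §10 p. 60] -/
def Eq1055a : Prop :=
  ∀ ε : ℝ, 0 < ε → ForAllLarge fun D _ χ => AssumptionA D χ → ∀ j ∈ ({1, 2, 3} : Finset ℕ),
    ‖drSum c' χ j (mSum12 c' χ j) (nSum14 c' χ j) 0 (bigP D ^ (0.496 : ℝ)) -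
        deriv χ.LFunction 1 ^ 2 / 500 * (betaJ c' D (j + 1) * betaJ c' D (j + 2)) *
          nAvg c' χ j 0 (bigP D ^ (0.496 : ℝ)) (fun n =>
            conj iota3 * frakfW c' D j 6 (bigP D ^ (0.498 : ℝ) / n) / 0.498 +
              conj iota4 * frakfW c' D j 7 (bigP D ^ (0.5 : ℝ) / n) / 0.5)‖ ≤ ε * alpha D

/-- **Node §10.u055, second line** (p. 60):
"`= (𝔞β_{j+1}β_{j+2}/500)∫_1^{P^{0.496}}(ῑ₃𝔣_{j6}(P^{0.498}/x)/0.498 + ῑ₄𝔣_{j7}(P^{0.5}/x)/0.5)dx/x + o(α)`".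
CLAIM. [cite: Zhang2022LandauSiegel, §10 p. 60] -/
def Eq1055b : Prop :=
  ∀ ε : ℝ, 0 < ε → ForAllLarge fun D _ χ => AssumptionA D χ → ∀ j ∈ ({1, 2, 3} : Finset ℕ),
    ‖deriv χ.LFunction 1 ^ 2 / 500 * (betaJ c' D (j + 1) * betaJ c' D (j + 2)) *
          nAvg c' χ j 0 (bigP D ^ (0.496 : ℝ)) (fun n =>
            conj iota3 * frakfW c' D j 6 (bigP D ^ (0.498 : ℝ) / n) / 0.498 +
              conj iota4 * frakfW c' D j 7 (bigP D ^ (0.5 : ℝ) / n) / 0.5) -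
        frakA χ * (betaJ c' D (j + 1) * betaJ c' D (j + 2)) / 500 *
          ∫ x in (1 : ℝ)..(bigP D ^ (0.496 : ℝ)),
            (conj iota3 * frakfW c' D j 6 (bigP D ^ (0.498 : ℝ) / x) / 0.498 +
              conj iota4 * frakfW c' D j 7 (bigP D ^ (0.5 : ℝ) / x) / 0.5) / (x : ℂ)‖ ≤ ε * alpha D

/-- **Node §10.u055, third line** (p. 60):
"`= (𝔞β_{j+1}β_{j+2}log P/500)∫_0^{0.496}(ῑ₃𝔣𝔣_{j6}(0.002 + z)/0.498 + ῑ₄𝔣𝔣_{j7}(0.004 + z)/0.5)dz + o(α)`".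
CLAIM. [cite: Zhang2022LandauSiegel, §10 p. 60] -/
def Eq1055c : Prop :=
  ∀ ε : ℝ, 0 < ε → ForAllLarge fun D _ χ => AssumptionA D χ → ∀ j ∈ ({1, 2, 3} : Finset ℕ),
    ‖frakA χ * (betaJ c' D (j + 1) * betaJ c' D (j + 2)) / 500 *
          (∫ x in (1 : ℝ)..(bigP D ^ (0.496 : ℝ)),
            (conj iota3 * frakfW c' D j 6 (bigP D ^ (0.498 : ℝ) / x) / 0.498 +
              conj iota4 * frakfW c' D j 7 (bigP D ^ (0.5 : ℝ) / x) / 0.5) / (x : ℂ)) -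
        frakA χ * (betaJ c' D (j + 1) * betaJ c' D (j + 2)) * logP D / 500 *
          ∫ z in (0 : ℝ)..0.496,
            (conj iota3 * ffSel j 6 (0.002 + z) / 0.498 + conj iota4 * ffSel j 7 (0.004 + z) / 0.5)‖
      ≤ ε * alpha D

/-- **Node §10.u056, first line** (p. 61): "the sum over `P^{0.496} ≤ dr < P^{0.498}` is equal to
`(500L′(1,χ)²/log²P)Σ_{P^{0.496}≤n<P^{0.498}} |χ(n)|λ₀ⱼ(n)φ(n)⁻¹(ῑ₃𝔣_{j6}(P^{0.498}/n)/0.498 + ῑ₄𝔣_{j7}(P^{0.5}/n)/0.5)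
(−1 + 𝔶₁ⱼ(P^{0.004}n)) + o(α)`" (printed `p^{0.496}`, note (vi)). CLAIM. [cite: Zhang2022LandauSiegel, §10 p. 61] -/
def Eq1056a : Prop :=
  ∀ ε : ℝ, 0 < ε → ForAllLarge fun D _ χ => AssumptionA D χ → ∀ j ∈ ({1, 2, 3} : Finset ℕ),
    ‖drSum c' χ j (mSum12 c' χ j) (nSum14 c' χ j) (bigP D ^ (0.496 : ℝ)) (bigP D ^ (0.498 : ℝ)) -
        500 * deriv χ.LFunction 1 ^ 2 / logP D ^ 2 *
          nAvg c' χ j (bigP D ^ (0.496 : ℝ)) (bigP D ^ (0.498 : ℝ)) (fun n =>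
            (conj iota3 * frakfW c' D j 6 (bigP D ^ (0.498 : ℝ) / n) / 0.498 +
                conj iota4 * frakfW c' D j 7 (bigP D ^ (0.5 : ℝ) / n) / 0.5) *
              (-1 + fraky1 c' D j (bigP D ^ (0.004 : ℝ) * n)))‖ ≤ ε * alpha D

/-- **Node §10.u056, second line** (p. 61):
"`= (500𝔞/log P)∫_0^{0.002}(ῑ₃𝔣𝔣_{j6}(z)/0.498 + ῑ₄𝔣𝔣_{j7}(0.002 + z)/0.5)(−1 + 𝔶𝔶₁ⱼ(0.502 − z))dz + o(α)`".
CLAIM. [cite: Zhang2022LandauSiegel, §10 p. 61] -/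
def Eq1056b : Prop :=
  ∀ ε : ℝ, 0 < ε → ForAllLarge fun D _ χ => AssumptionA D χ → ∀ j ∈ ({1, 2, 3} : Finset ℕ),
    ‖500 * deriv χ.LFunction 1 ^ 2 / logP D ^ 2 *
          nAvg c' χ j (bigP D ^ (0.496 : ℝ)) (bigP D ^ (0.498 : ℝ)) (fun n =>
            (conj iota3 * frakfW c' D j 6 (bigP D ^ (0.498 : ℝ) / n) / 0.498 +
                conj iota4 * frakfW c' D j 7 (bigP D ^ (0.5 : ℝ) / n) / 0.5) *
              (-1 + fraky1 c' D j (bigP D ^ (0.004 : ℝ) * n))) -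
        500 * frakA χ / logP D *
          ∫ z in (0 : ℝ)..0.002,
            (conj iota3 * ffSel j 6 z / 0.498 + conj iota4 * ffSel j 7 (0.002 + z) / 0.5) *
              (-1 + yy1Sel j (0.502 - z))‖ ≤ ε * alpha D

/-- **Node §10.u057, first line** (p. 61): "the sum over `P^{0.498} ≤ dr < P^{0.5}` is equal to
`(1000ῑ₄L′(1,χ)²/log²P)Σ_{P^{0.498}≤n<P^{0.5}} |χ(n)|λ₀ⱼ(n)φ(n)⁻¹𝔣_{j7}(P^{0.5}/n)(1 + 𝔶₂ⱼ(P^{0.004}n)) + o(α)`."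
CLAIM. [cite: Zhang2022LandauSiegel, §10 p. 61] -/
def Eq1057a : Prop :=
  ∀ ε : ℝ, 0 < ε → ForAllLarge fun D _ χ => AssumptionA D χ → ∀ j ∈ ({1, 2, 3} : Finset ℕ),
    ‖drSum c' χ j (mSum12 c' χ j) (nSum14 c' χ j) (bigP D ^ (0.498 : ℝ)) (bigP D ^ (0.5 : ℝ)) -
        1000 * conj iota4 * deriv χ.LFunction 1 ^ 2 / logP D ^ 2 *
          nAvg c' χ j (bigP D ^ (0.498 : ℝ)) (bigP D ^ (0.5 : ℝ)) (fun n =>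
            frakfW c' D j 7 (bigP D ^ (0.5 : ℝ) / n) * (1 + fraky2 c' D j (bigP D ^ (0.004 : ℝ) * n)))‖
      ≤ ε * alpha D

/-- **Node §10.u057, second line** (p. 61):
"`= (1000ῑ₄𝔞/log P)∫_0^{0.002}𝔣𝔣_{j7}(z)(1 + 𝔶𝔶₂ⱼ(0.504 − z))dz + o(α)`". CLAIM.
[cite: Zhang2022LandauSiegel, §10 p. 61] -/
def Eq1057b : Prop :=
  ∀ ε : ℝ, 0 < ε → ForAllLarge fun D _ χ => AssumptionA D χ → ∀ j ∈ ({1, 2, 3} : Finset ℕ),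
    ‖1000 * conj iota4 * deriv χ.LFunction 1 ^ 2 / logP D ^ 2 *
          nAvg c' χ j (bigP D ^ (0.498 : ℝ)) (bigP D ^ (0.5 : ℝ)) (fun n =>
            frakfW c' D j 7 (bigP D ^ (0.5 : ℝ) / n) * (1 + fraky2 c' D j (bigP D ^ (0.004 : ℝ) * n))) -
        1000 * conj iota4 * frakA χ / logP D *
          ∫ z in (0 : ℝ)..0.002, ffSel j 7 z * (1 + yy2Sel j (0.504 - z))‖ ≤ ε * alpha D

/-- **Node §10.u058** (p. 61): "Gathering the above results together we conclude
`α⁻¹S_j(𝐚₁₂,𝐚₁₄) = (d′₆ⱼ + d₆ⱼ)𝔞 + o(1)`" with the printed `d′₆ⱼ` ((10.15) = tree `d6pF`) and `d₆ⱼ`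
(node u059 = tree `d6F`). CLAIM (literal `o(1)`, note (v)). [cite: Zhang2022LandauSiegel, §10 p. 61] -/
def Concl1214 : Prop :=
  ∀ ε : ℝ, 0 < ε → ForAllLarge fun D _ χ => AssumptionA D χ → ∀ j ∈ ({1, 2, 3} : Finset ℕ),
    ‖Sj c' D j (a12 χ) (a14 χ) / alpha D - (d6pSel j + d6Sel j) * frakA χ‖ ≤ ε

/-- **(10.16)** (p. 61): "Hence, by Proposition 7.1,
`Θ₁(𝐚₁₂,𝐚₁₄) = (½(d′₆₁ + d₆₁) + 2(d′₆₂ + d₆₂) + 3/2(d′₆₃ + d₆₃))𝔞𝔓 + o(𝔓)`" (printed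
`3/2 d′₆₃ + d₆₃))`, note (ii)). CLAIM. [cite: Zhang2022LandauSiegel, §10 (10.16) p. 61] -/
def Eq1016 : Prop :=
  ∀ ε : ℝ, 0 < ε → ForAllLarge fun D _ χ => AssumptionA D χ →
    ‖Theta1 c' χ (a12 χ) (a14 χ) -
        (1 / 2 * (d6p1 + d61) + 2 * (d6p2 + d62) + 3 / 2 * (d6p3 + d63)) * frakA χ * frakP D‖
      ≤ ε * frakP D

/-! ## p. 61: (10.17) from (10.1) and (10.12)–(10.16) -/

/-- **"It follows from (10.1) and (10.12)–(10.16) that (10.17)"** (p. 61): the last step of the §10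
computation as an implication between the typed displays, refining the skeleton's coarse proof node
`Skeleton.Ded1017` ((10.17) = `Skeleton.Eval1017`, `𝔡′ = dprime`, `𝔡 = dfrak`). PROVED below
(`ded1017Fine_holds`). [cite: Zhang2022LandauSiegel, §10 (10.17) p. 61] -/
def Ded1017Fine : Prop := Eq101 c' → Eq1012 c' → Eq1013 c' → Eq1014 c' → Eq1016 c' → Eval1017 c'

end Claims

/-! ## Kernel edges -/

section Edges

/-- The printed `𝔡′ + 𝔡` IS the sum of the four coefficients of (10.12)–(10.16) combined as in (10.1)
(second and fourth conjugated): pure algebra on the tree's `dprime`, `dfrak`.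
[cite: Zhang2022LandauSiegel, §10 (10.17) p. 61] -/
theorem dprime_add_dfrak_eq :
    dprime + dfrak =
      (1 / 2 * d31 + 2 * d32 + 3 / 2 * d33) + conj (1 / 2 * d41 + 2 * d42 + 3 / 2 * d43) +
        (1 / 2 * (d5p1 + d51) + 2 * (d5p2 + d52) + 3 / 2 * (d5p3 + d53)) +
        conj (1 / 2 * (d6p1 + d61) + 2 * (d6p2 + d62) + 3 / 2 * (d6p3 + d63)) := by
  simp only [dprime, dfrak, map_add, map_mul, map_div₀, map_one, map_ofNat]
  ring

/-- **EDGE (PROVED): (10.1) + (10.12) + (10.13) + (10.14) + (10.16) ⇒ (10.17)** — the manuscript's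
"It follows from (10.1) and (10.12)–(10.16) that `Ξ₁* = (𝔡′ + 𝔡)𝔞𝔓 + o(𝔓)`", kernel-checked over the
skeleton's objects (`ε/5` bookkeeping; `𝔞`, `𝔓` real). [cite: Zhang2022LandauSiegel, §10 (10.17) p. 61] -/
theorem ded1017Fine_holds (c' : ℝ) : Ded1017Fine c' := by
  intro h101 h12 h13 h14 h16 ε hε
  have hε5 : 0 < ε / 5 := by positivity
  obtain ⟨D₀, H⟩ := ((h101 (ε / 5) hε5).and (h12 (ε / 5) hε5)).and
    (((h13 (ε / 5) hε5).and (h14 (ε / 5) hε5)).and (h16 (ε / 5) hε5))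
  refine ⟨D₀, fun D _ χ hD hq hp hA => ?_⟩
  obtain ⟨⟨k101, k12⟩, ⟨k13, k14⟩, k16⟩ := H D χ hD hq hp
  have e101 := k101 hA
  have e12 := k12 hA
  have e13 := k13 hA
  have e14 := k14 hA
  have e16 := k16 hA
  -- conjugated versions of (10.13) and (10.16)
  have e13' : ‖conj (Theta1 c' χ (a13 χ) (a21 χ)) -
      conj (1 / 2 * d41 + 2 * d42 + 3 / 2 * d43) * frakA χ * frakP D‖ ≤ ε / 5 * frakP D := by
    have := e13
    rw [← Complex.norm_conj] at this
    simpa [map_sub, map_mul, Complex.conj_ofReal] using this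
  have e16' : ‖conj (Theta1 c' χ (a12 χ) (a14 χ)) -
      conj (1 / 2 * (d6p1 + d61) + 2 * (d6p2 + d62) + 3 / 2 * (d6p3 + d63)) * frakA χ * frakP D‖
        ≤ ε / 5 * frakP D := by
    have := e16
    rw [← Complex.norm_conj] at this
    simpa [map_sub, map_mul, Complex.conj_ofReal] using this
  rw [dprime_add_dfrak_eq]
  -- telescope
  have key : xiStar1 c' χ -
      ((1 / 2 * d31 + 2 * d32 + 3 / 2 * d33) + conj (1 / 2 * d41 + 2 * d42 + 3 / 2 * d43) +
        (1 / 2 * (d5p1 + d51) + 2 * (d5p2 + d52) + 3 / 2 * (d5p3 + d53)) +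
        conj (1 / 2 * (d6p1 + d61) + 2 * (d6p2 + d62) + 3 / 2 * (d6p3 + d63))) * frakA χ * frakP D =
    (xiStar1 c' χ - (Theta1 c' χ (a11 χ) (a13 χ) + conj (Theta1 c' χ (a13 χ) (a21 χ)) +
        Theta1 c' χ (a14 χ) (a22 χ) + conj (Theta1 c' χ (a12 χ) (a14 χ)))) +
      (Theta1 c' χ (a11 χ) (a13 χ) - (1 / 2 * d31 + 2 * d32 + 3 / 2 * d33) * frakA χ * frakP D) +
      (conj (Theta1 c' χ (a13 χ) (a21 χ)) -
        conj (1 / 2 * d41 + 2 * d42 + 3 / 2 * d43) * frakA χ * frakP D) +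
      (Theta1 c' χ (a14 χ) (a22 χ) -
        (1 / 2 * (d5p1 + d51) + 2 * (d5p2 + d52) + 3 / 2 * (d5p3 + d53)) * frakA χ * frakP D) +
      (conj (Theta1 c' χ (a12 χ) (a14 χ)) -
        conj (1 / 2 * (d6p1 + d61) + 2 * (d6p2 + d62) + 3 / 2 * (d6p3 + d63)) * frakA χ *
          frakP D) := by ring
  rw [key]
  calc _ ≤ ‖xiStar1 c' χ - (Theta1 c' χ (a11 χ) (a13 χ) + conj (Theta1 c' χ (a13 χ) (a21 χ)) +
          Theta1 c' χ (a14 χ) (a22 χ) + conj (Theta1 c' χ (a12 χ) (a14 χ)))‖ +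
        ‖Theta1 c' χ (a11 χ) (a13 χ) - (1 / 2 * d31 + 2 * d32 + 3 / 2 * d33) * frakA χ * frakP D‖ +
        ‖conj (Theta1 c' χ (a13 χ) (a21 χ)) -
          conj (1 / 2 * d41 + 2 * d42 + 3 / 2 * d43) * frakA χ * frakP D‖ +
        ‖Theta1 c' χ (a14 χ) (a22 χ) -
          (1 / 2 * (d5p1 + d51) + 2 * (d5p2 + d52) + 3 / 2 * (d5p3 + d53)) * frakA χ * frakP D‖ +
        ‖conj (Theta1 c' χ (a12 χ) (a14 χ)) -
          conj (1 / 2 * (d6p1 + d61) + 2 * (d6p2 + d62) + 3 / 2 * (d6p3 + d63)) * frakA χ *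
            frakP D‖ := by
          refine le_trans (norm_add_le _ _) ?_
          gcongr
          refine le_trans (norm_add_le _ _) ?_
          gcongr
          refine le_trans (norm_add_le _ _) ?_
          gcongr
          exact norm_add_le _ _
    _ ≤ ε / 5 * frakP D + ε / 5 * frakP D + ε / 5 * frakP D + ε / 5 * frakP D + ε / 5 * frakP D := by
          gcongr
    _ = ε * frakP D := by ring

variable (c' : ℝ) in
/-- `Ded1017Fine` — `_holds` alias of `ded1017Fine_holds` above under the fact's exact name, stated under the
prover's own binders as section variables (appended 2026-08-28, D-0026 bookkeeping: the proof term is the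
existing theorem of this file; no statement, definition or attribute is edited; no new named fact; the
ledger's debt table listed the fact unproved). [cite: Zhang2022LandauSiegel, §10 (10.17) p. 61] -/
theorem _root_.Literature.NumberTheory.LFunctions.Zhang2022.Typed.Sec10B.Ded1017Fine_holds :
    _root_.Literature.NumberTheory.LFunctions.Zhang2022.Typed.Sec10B.Ded1017Fine c' :=
  _root_.Literature.NumberTheory.LFunctions.Zhang2022.Typed.Sec10B.ded1017Fine_holds (c' := c')

/-- `log(y·m)/log P + 0.004 − α̃ = log(y*·m)/log P` with `y* = yP^{0.004}/(Dt₀)`: the shifted sum IS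
`𝔳₁ⱼ` at `y*` (`y > 0`, `D ≥ 2`). [cite: Zhang2022LandauSiegel, §10 p. 57] -/
theorem frakv1S_eq_frakv1 (c' : ℝ) {D : ℕ} (χ : DirichletCharacter ℂ D) (hD : 2 ≤ D) (j : ℕ)
    {y : ℝ} (hy : 0 < y) :
    frakv1S c' χ j y = frakv1 c' χ j (yShift D y) := by
  unfold frakv1S frakv1 yShift
  refine Finset.sum_congr rfl fun m hm => ?_
  rw [Finset.mem_Ico] at hm
  have hm0 : (0 : ℝ) < m := by exact_mod_cast hm.1
  have hD1 : (1 : ℝ) < D := by exact_mod_cast hD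
  have hell : 0 < ell D := Real.log_pos hD1
  have hP : 0 < bigP D := Real.exp_pos _
  have hlogP : Real.log (bigP D) ≠ 0 := by
    rw [bigP, Real.log_exp]; positivity
  have ht0 : 0 < t0 D := by rw [t0]; positivity
  have hDt : 0 < (D : ℝ) * t0 D := by positivity
  have hpow : 0 < bigP D ^ (0.004 : ℝ) := Real.rpow_pos_of_pos hP _
  have hys : 0 < y * bigP D ^ (0.004 : ℝ) / (D * t0 D) := by positivity
  have harg : Real.log (y * m) / Real.log (bigP D) + 0.004 - alphaTilde D =
      Real.log (y * bigP D ^ (0.004 : ℝ) / (D * t0 D) * m) / Real.log (bigP D) := by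
    rw [alphaTilde, Real.log_mul hy.ne' hm0.ne', Real.log_mul hys.ne' hm0.ne',
      Real.log_div (by positivity) hDt.ne', Real.log_mul hy.ne' hpow.ne', Real.log_rpow hP]
    field_simp
    ring
  rw [harg]

/-- **EDGE (PROVED): Lemma 10.1 ⇒ its "simple modification" for the shifted sum** (node u032):
`Skeleton.Lemma101 c′ → Lemma101S c′` (substitution `y ↦ y* = yP^{0.004}/(Dt₀)`).
[cite: Zhang2022LandauSiegel, §10 p. 57] -/
theorem lemma101S_of_lemma101 (c' : ℝ) (h : Lemma101 c') : Lemma101S c' := by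
  obtain ⟨c, hc, C, D₀, H⟩ := h
  refine ⟨c, hc, C, max D₀ 2, fun D _ χ hD hq hp hA j hj y => ?_⟩
  have hD₀ : D₀ ≤ D := le_trans (le_max_left _ _) hD
  have hD2 : 2 ≤ D := le_trans (le_max_right _ _) hD
  have key := H D χ hD₀ hq hp hA j hj (yShift D y)
  have hP : 0 < bigP D := Real.exp_pos _
  have hD1 : (1 : ℝ) < D := by exact_mod_cast hD2
  have ht0 : 0 < t0 D := by rw [t0]; exact pow_pos (Real.log_pos hD1) _
  have hDt : 0 < (D : ℝ) * t0 D := by positivity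
  have hpow : 0 < bigP D ^ (0.004 : ℝ) := Real.rpow_pos_of_pos hP _
  have hT : 0 < bigT D := Real.exp_pos _
  -- `y > 0` as soon as `y* > 0`; every clause carries a hypothesis forcing `y* > 0`
  have ypos : 0 < yShift D y → 0 < y := fun h0 =>
    (mul_pos_iff_of_pos_right hpow).mp ((div_pos_iff_of_pos_right hDt).mp h0)
  have hfr : 0 < yShift D y → frakv1S c' χ j y = frakv1 c' χ j (yShift D y) := fun h0 =>
    frakv1S_eq_frakv1 c' χ hD2 j (ypos h0)
  refine ⟨fun h1 h2 => ?_, fun h1 h2 => ?_, fun h1 h2 => ?_, fun h1 => ?_⟩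
  · rw [hfr (lt_of_lt_of_le one_pos h1)]
    exact key.1 h1 h2
  · rw [hfr (lt_trans (Real.rpow_pos_of_pos hP _) h1)]
    exact key.2.1 h1 h2
  · rw [hfr (lt_trans (Real.rpow_pos_of_pos hP _) h1)]
    exact key.2.2.1 h1 h2
  · have h0 : 0 < yShift D y := by
      rcases h1 with ⟨h, _⟩ | ⟨h, _⟩ | ⟨h, _⟩ <;>
        exact lt_trans (div_pos (Real.rpow_pos_of_pos hP _) hT) h
    rw [hfr h0]
    exact key.2.2.2 h1

end Edges

/-! ## Record (L3-lead LEDGER #2, 2026-08-25T23:44Z): of-record scope of this file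

Under plan/L3/ASSIGNMENTS.md v1.1 this file is OF RECORD for Z22:§10.u027–u046, (10.12), (10.13)
(pp. 56–59, TeX L2869–L3012). Its declarations for Z22:§10.u047–u067 and (10.14)–(10.16)
(`IdSj1422`, `Split1422`, `Small1422`, `Eq1049a/b`, `Eq1050a/b`, `Concl1422`, `Eq1014`,
`IdSj1214`, `Split1214`, `Eq1055a/b/c`, `Eq1056a/b`, `Eq1057a/b`, `Concl1214`, `Eq1016`,
`Ded1017Fine`/`ded1017Fine_holds`, `dprimeLead`, `d5pSel`, `d5Sel`, `d6pSel`, `d6Sel`) are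
SUPPLEMENTARY: the file of record for those nodes is `TypedSection10C.lean`
(`…Zhang2022.Typed.Sec10C`), and they are not discharge targets.

## Discharges (§10b, of record): the `S_j` identities u034/u042 and the range splits are exact -/

section Discharges

/-- For a real (quadratic) character, `χ(a)² = |χ(a)|` (the step behind "`|χ(d)||μχ(r)|`" in the
`S_j` displays of §10). [cite: Zhang2022LandauSiegel, §10 p. 57] -/
theorem mul_self_eq_norm_of_isQuadratic {D : ℕ} (χ : DirichletCharacter ℂ D)
    (hq : χ.IsQuadratic) (a : ZMod D) : χ a * χ a = (‖χ a‖ : ℂ) := by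
  rcases hq a with h | h | h <;> simp [h]

/-- `|μ(r)|·χ(r)² = |μ(r)χ(r)|` for a real character (the weight `|μχ(r)|` of §10).
[cite: Zhang2022LandauSiegel, §10 p. 57] -/
theorem moebius_natAbs_mul_eq_norm {D : ℕ} (χ : DirichletCharacter ℂ D) (hq : χ.IsQuadratic)
    (r : ℕ) :
    ((ArithmeticFunction.moebius r).natAbs : ℂ) * (χ (r : ZMod D) * χ (r : ZMod D)) =
      (‖((ArithmeticFunction.moebius r : ℤ) : ℂ) * χ (r : ZMod D)‖ : ℂ) := by
  rw [mul_self_eq_norm_of_isQuadratic χ hq, norm_mul, Complex.ofReal_mul, Complex.norm_intCast,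
    ← Int.cast_abs, Complex.ofReal_intCast, Nat.cast_natAbs]

/-- `χ(drm) = χ(d)χ(r)χ(m)` (complete multiplicativity, as used in the `S_j` displays of §10).
[cite: Zhang2022LandauSiegel, §10 p. 57] -/
theorem chi_mul_three {D : ℕ} (χ : DirichletCharacter ℂ D) (d r m : ℕ) :
    χ ((d * r * m : ℕ) : ZMod D) = χ (d : ZMod D) * χ (r : ZMod D) * χ (m : ZMod D) := by
  push_cast
  rw [map_mul, map_mul]

/-- The common core of the four identities: once both inner sums factor as `χ(d)χ(r)·(…)`, the
`Skeleton.Sj` summand is the printed `|χ(d)||μχ(r)|λ₀ⱼ(dr)/(drφ(r))·M·N` summand.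
[cite: Zhang2022LandauSiegel, §10 p. 57] -/
theorem Sj_eq_drSumAll (c' : ℝ) {D : ℕ} (χ : DirichletCharacter ℂ D) (hq : χ.IsQuadratic) (j : ℕ)
    (a₁ a₂ : ℕ → ℂ) (M : ℕ → ℂ) (N : ℕ → ℕ → ℂ)
    (hM : ∀ d r, ∑ m ∈ Finset.Ico 1 (Nsupp D), a₁ (d * r * m) / (m : ℂ) ^ (1 - betaJ c' D j) =
      χ (d : ZMod D) * χ (r : ZMod D) * M (d * r))
    (hN : ∀ d r, ∑ n ∈ Finset.Ico 1 (Nsupp D), a₂ (d * r * n) * xiZero c' D j n d r / (n : ℂ) =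
      χ (d : ZMod D) * χ (r : ZMod D) * N d r) :
    Sj c' D j a₁ a₂ = drSumAll c' χ j M N := by
  unfold Sj drSumAll drWeight
  refine Finset.sum_congr rfl fun d _ => Finset.sum_congr rfl fun r _ => ?_
  rw [hM, hN, ← mul_self_eq_norm_of_isQuadratic χ hq (d : ZMod D),
    ← moebius_natAbs_mul_eq_norm χ hq r]
  ring

/-- **DISCHARGED: node §10.u034** — `IdSj1113` holds (exact identity for real `χ`).
[cite: Zhang2022LandauSiegel, §10 p. 57] -/
theorem idSj1113_holds (c' : ℝ) : IdSj1113 c' := by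
  intro D _ χ hq j
  refine Sj_eq_drSumAll c' χ hq j _ _ _ _ (fun d r => ?_) (fun d r => ?_)
  · unfold mSum11
    rw [Finset.mul_sum]
    refine Finset.sum_congr rfl fun m _ => ?_
    unfold a11
    rw [chi_mul_three]
    ring
  · unfold nSum13
    rw [Finset.mul_sum]
    refine Finset.sum_congr rfl fun n _ => ?_
    unfold a13
    rw [chi_mul_three]
    ring

variable (c' : ℝ) in
/-- `IdSj1113` — `_holds` alias of `idSj1113_holds` above under the fact's exact name, stated under the
prover's own binders as section variables (appended 2026-08-28, D-0026 bookkeeping: the proof term is the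
existing theorem of this file; no statement, definition or attribute is edited; no new named fact; the
ledger's debt table listed the fact unproved). [cite: Zhang2022LandauSiegel, §10 p. 57] -/
theorem _root_.Literature.NumberTheory.LFunctions.Zhang2022.Typed.Sec10B.IdSj1113_holds :
    _root_.Literature.NumberTheory.LFunctions.Zhang2022.Typed.Sec10B.IdSj1113 c' :=
  _root_.Literature.NumberTheory.LFunctions.Zhang2022.Typed.Sec10B.idSj1113_holds (c' := c')

/-- **DISCHARGED: node §10.u042** — `IdSj1321` holds. [cite: Zhang2022LandauSiegel, §10 p. 58] -/
theorem idSj1321_holds (c' : ℝ) : IdSj1321 c' := by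
  intro D _ χ hq j
  have hreal : ∀ a : ZMod D, conj (χ a) = χ a := fun a => by
    rcases hq a with h | h | h <;> simp [h]
  refine Sj_eq_drSumAll c' χ hq j _ _ _ _ (fun d r => ?_) (fun d r => ?_)
  · unfold mSum13
    rw [Finset.mul_sum]
    refine Finset.sum_congr rfl fun m _ => ?_
    unfold a13
    rw [chi_mul_three]
    ring
  · unfold nSum21
    rw [Finset.mul_sum]
    refine Finset.sum_congr rfl fun n _ => ?_
    unfold a21 a11
    rw [map_mul, hreal, chi_mul_three, map_add, map_mul]
    ring

variable (c' : ℝ) in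
/-- `IdSj1321` — `_holds` alias of `idSj1321_holds` above under the fact's exact name, stated under the
prover's own binders as section variables (appended 2026-08-28, D-0026 bookkeeping: the proof term is the
existing theorem of this file; no statement, definition or attribute is edited; no new named fact; the
ledger's debt table listed the fact unproved). [cite: Zhang2022LandauSiegel, §10 p. 58] -/
theorem _root_.Literature.NumberTheory.LFunctions.Zhang2022.Typed.Sec10B.IdSj1321_holds :
    _root_.Literature.NumberTheory.LFunctions.Zhang2022.Typed.Sec10B.IdSj1321 c' :=
  _root_.Literature.NumberTheory.LFunctions.Zhang2022.Typed.Sec10B.idSj1321_holds (c' := c')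

/-! ### The range splits (u035 and the split of `S_j(𝐚₁₃,𝐚₂₁)`) -/

/-- Splitting a `(d,r)`-double sum into the three printed `dr`-ranges, when the summand vanishes for
`dr ≥ c`. [cite: Zhang2022LandauSiegel, §10 p. 57] -/
theorem sum_split_three (S : Finset ℕ) (W : ℕ → ℕ → ℂ) {a b c : ℝ} (hab : a ≤ b)
    (hvan : ∀ d r, c ≤ ((d * r : ℕ) : ℝ) → W d r = 0) :
    ∑ d ∈ S, ∑ r ∈ S, W d r =
      (∑ d ∈ S, ∑ r ∈ S, if 0 ≤ ((d * r : ℕ) : ℝ) ∧ ((d * r : ℕ) : ℝ) < a then W d r else 0) +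
        (∑ d ∈ S, ∑ r ∈ S, if a ≤ ((d * r : ℕ) : ℝ) ∧ ((d * r : ℕ) : ℝ) < b then W d r else 0) +
        (∑ d ∈ S, ∑ r ∈ S, if b ≤ ((d * r : ℕ) : ℝ) ∧ ((d * r : ℕ) : ℝ) < c then W d r else 0) := by
  rw [← Finset.sum_add_distrib, ← Finset.sum_add_distrib]
  refine Finset.sum_congr rfl fun d _ => ?_
  rw [← Finset.sum_add_distrib, ← Finset.sum_add_distrib]
  refine Finset.sum_congr rfl fun r _ => ?_
  have h0 : (0 : ℝ) ≤ ((d * r : ℕ) : ℝ) := Nat.cast_nonneg _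
  by_cases ha : ((d * r : ℕ) : ℝ) < a
  · rw [if_pos ⟨h0, ha⟩, if_neg (fun h => absurd ha (not_lt.mpr h.1)),
      if_neg (fun h => absurd (lt_of_lt_of_le ha hab) (not_lt.mpr h.1))]
    ring
  rw [not_lt] at ha
  by_cases hb : ((d * r : ℕ) : ℝ) < b
  · rw [if_neg (fun h => absurd h.2 (not_lt.mpr ha)), if_pos ⟨ha, hb⟩,
      if_neg (fun h => absurd hb (not_lt.mpr h.1))]
    ring
  rw [not_lt] at hb
  by_cases hc : ((d * r : ℕ) : ℝ) < c
  · rw [if_neg (fun h => absurd h.2 (not_lt.mpr ha)),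
      if_neg (fun h => absurd h.2 (not_lt.mpr hb)), if_pos ⟨hb, hc⟩]
    ring
  rw [not_lt] at hc
  rw [if_neg (fun h => absurd h.2 (not_lt.mpr ha)), if_neg (fun h => absurd h.2 (not_lt.mpr hb)),
    if_neg (fun h => absurd h.2 (not_lt.mpr hc)), hvan d r hc]
  ring

/-- `1 ≤ P` always (`P = exp{𝓛⁹}`, `𝓛 = log D ≥ 0`). [cite: Zhang2022LandauSiegel, §2 (2.6)] -/
private theorem one_le_bigP (D : ℕ) : 1 ≤ bigP D := by
  rw [bigP]
  exact Real.one_le_exp (pow_nonneg (by rw [ell]; exact Real.log_natCast_nonneg D) _)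

/-- `f̃(log(k)/log P) = 0` as soon as `k ≥ P^{0.504}` (`k ≥ 1`).
[cite: Zhang2022LandauSiegel, §2 (2.28)] -/
theorem ftilde_log_eq_zero {D k : ℕ} (hP : bigP D ^ (0.504 : ℝ) ≤ (k : ℝ)) :
    ftilde (Real.log (k : ℝ) / Real.log (bigP D)) = 0 := by
  have hP1 : 1 ≤ bigP D := one_le_bigP D
  rcases (Real.log_nonneg hP1).eq_or_lt with h0 | hpos
  · rw [← h0, div_zero]
    unfold ftilde
    norm_num
  · apply Lemma101.ftilde_eq_zero_of_ge
    rw [le_div_iff₀ hpos, ← Real.log_rpow (lt_of_lt_of_le one_pos hP1)]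
    exact Real.log_le_log (Real.rpow_pos_of_pos (lt_of_lt_of_le one_pos hP1) _) hP

/-- `nSum13 = 0` for `dr ≥ P^{0.504}`. [cite: Zhang2022LandauSiegel, §10 p. 57] -/
theorem nSum13_eq_zero (c' : ℝ) {D : ℕ} (χ : DirichletCharacter ℂ D) (j d r : ℕ)
    (h : bigP D ^ (0.504 : ℝ) ≤ ((d * r : ℕ) : ℝ)) : nSum13 c' χ j d r = 0 := by
  unfold nSum13
  refine Finset.sum_eq_zero fun n hn => ?_
  rw [Finset.mem_Ico] at hn
  have hk : bigP D ^ (0.504 : ℝ) ≤ ((d * r * n : ℕ) : ℝ) := by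
    refine h.trans ?_
    exact_mod_cast Nat.le_mul_of_pos_right _ hn.1
  rw [ftilde_log_eq_zero hk]
  simp

/-- `mSum13 (dr) = 0` for `dr ≥ P^{0.504}`. [cite: Zhang2022LandauSiegel, §10 p. 58] -/
theorem mSum13_eq_zero (c' : ℝ) {D : ℕ} (χ : DirichletCharacter ℂ D) (j y : ℕ)
    (h : bigP D ^ (0.504 : ℝ) ≤ (y : ℝ)) : mSum13 c' χ j y = 0 := by
  unfold mSum13
  refine Finset.sum_eq_zero fun m hm => ?_
  rw [Finset.mem_Ico] at hm
  have hk : bigP D ^ (0.504 : ℝ) ≤ ((y * m : ℕ) : ℝ) := by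
    refine h.trans ?_
    exact_mod_cast Nat.le_mul_of_pos_right _ hm.1
  rw [ftilde_log_eq_zero hk]
  simp

/-- Monotonicity of the breakpoints `P^{a}` in the exponent (`P ≥ 1`). [cite: Zhang2022LandauSiegel, §2 (2.6)] -/
theorem bigP_rpow_le {D : ℕ} {a b : ℝ} (hab : a ≤ b) : bigP D ^ a ≤ bigP D ^ b :=
  Real.rpow_le_rpow_of_exponent_le (one_le_bigP D) hab

/-- **DISCHARGED: node §10.u035** — `Split1113` holds (exact). [cite: Zhang2022LandauSiegel, §10 p. 57] -/
theorem split1113_holds (c' : ℝ) : Split1113 c' := by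
  intro D _ χ j
  unfold drSumAll drSum
  refine sum_split_three _ _ (bigP_rpow_le (by norm_num)) fun d r h => ?_
  rw [nSum13_eq_zero c' χ j d r h, mul_zero]

variable (c' : ℝ) in
/-- `Split1113` — `_holds` alias of `split1113_holds` above under the fact's exact name, stated under the
prover's own binders as section variables (appended 2026-08-28, D-0026 bookkeeping: the proof term is the
existing theorem of this file; no statement, definition or attribute is edited; no new named fact; the
ledger's debt table listed the fact unproved). [cite: Zhang2022LandauSiegel, §10 p. 57] -/
theorem _root_.Literature.NumberTheory.LFunctions.Zhang2022.Typed.Sec10B.Split1113_holds :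
    _root_.Literature.NumberTheory.LFunctions.Zhang2022.Typed.Sec10B.Split1113 c' :=
  _root_.Literature.NumberTheory.LFunctions.Zhang2022.Typed.Sec10B.split1113_holds (c' := c')

/-- **DISCHARGED: split of `S_j(𝐚₁₃,𝐚₂₁)`** — `Split1321` holds (exact).
[cite: Zhang2022LandauSiegel, §10 p. 58] -/
theorem split1321_holds (c' : ℝ) : Split1321 c' := by
  intro D _ χ j
  unfold drSumAll drSum
  refine sum_split_three _ _ (bigP_rpow_le (by norm_num)) fun d r h => ?_
  rw [mSum13_eq_zero c' χ j (d * r) h, mul_zero, zero_mul]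

variable (c' : ℝ) in
/-- `Split1321` — `_holds` alias of `split1321_holds` above under the fact's exact name, stated under the
prover's own binders as section variables (appended 2026-08-28, D-0026 bookkeeping: the proof term is the
existing theorem of this file; no statement, definition or attribute is edited; no new named fact; the
ledger's debt table listed the fact unproved). [cite: Zhang2022LandauSiegel, §10 p. 58] -/
theorem _root_.Literature.NumberTheory.LFunctions.Zhang2022.Typed.Sec10B.Split1321_holds :
    _root_.Literature.NumberTheory.LFunctions.Zhang2022.Typed.Sec10B.Split1321 c' :=
  _root_.Literature.NumberTheory.LFunctions.Zhang2022.Typed.Sec10B.split1321_holds (c' := c')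

end Discharges

end Literature.NumberTheory.LFunctions.Zhang2022.Typed.Sec10B
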